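import Literature.MathematicalPhysics.QuantumFieldTheory.Balaban1983to89.Beta.AveragingHessianKernels
import Literature.MathematicalPhysics.QuantumFieldTheory.Balaban1983to89.Beta.LogHolonomySecondJet

/-!
# `Balaban1983to89.Beta.AveragingHessianJets` — the RAY JETS of Bałaban's one-step covariant averaging (15)/(42):
# a log-free two-jet calculus at `0` and the IDENTIFICATION of node 7a's letter functionals `linAvg`, `hessU`, `vhU`
# with the first and second Taylor coefficients of local logarithms of (42) along the rays
# `r ↦ (e^{rσW_f} e^{rτB_f})_f` (product chart, fluctuation LEFT): (14) as the linear term (THEOREM P), the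
# product-chart jets (THEOREM A), the re-centred (V-H) stencil = an2's (b1) (THEOREM B), the polarised W-Hessian =
# an2's (b2) (THEOREM H), v1

HONEST FRAMING (page 1, mandatory).  This leaf belongs to the β sub-cell of the Bałaban audit, whose END STATEMENT is:
discharging the one-loop hypothesis `FlowStep.BetaPertH` (read at END-STATEMENT grade, RULING (R6)) makes Bałaban's
ultraviolet stability theorem for 4-d lattice Yang–Mills ([Balaban1989LargeFieldII], Thm. 1 p. 355 (B16))
UNCONDITIONAL inside this package — a real constructive-QFT result; it is NOT the continuum limit and NOT the Clay
problem.  Gloss 2: EVERYTHING below is kernel-proved [folklore] asymptotics (`=o[𝓝 0]`, `=O[𝓝 0]`) in a complete normed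
algebra, algebra of finite letter lists and finite sums on `ℤ^d`; NOTHING is cited as a fact.  [Balaban1985Averaging]
(= B7, CMP 98 (1985) 17–51) and [Balaban1985BackgroundPropagators] (= B9, CMP 99 (1985) 389–434) are quoted only to
say WHICH objects are being typed; the manuscripts under audit are not citable for their disputed steps and no
programme-internal claim enters.

ABSOLUTE RULE (cell charter, verbatim; header line added v1.0.2 per beta-ref advisory A-R371, docstring-only): «No
internally-minted statement may enter as a cited fact. Every hypothesis is either kernel-proved in this package or a
verbatim quotation of a PUBLISHED theorem with page reference. The manuscript(s) under audit are NOT citable for their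
own disputed steps — they are the thing under adjudication; programme-internal (2001/route/tribunal) claims are never
citable.»  Accordingly NO declaration below is a `def … : Prop` carrying a citation and no hypothesis of any theorem is
a printed statement: every declaration is [folklore]; the quotations are object LOCATORS only.

THE PRINTED OBJECTS (locators, verbatim; re-read for this module as page images, 2026-08-19, from the renders
`b2b-balaban-ref1/pages/1985-cmp98-averaging/1985-cmp98-averaging-p003/p004/p007-x2.png` = B7 pp.19–20, 23 (journal
page = PDF page + 16) and `…/1985-cmp99-background-propagators/…-p004/p005-x2.png` = B9 pp.392–393 (journal page = PDF
page + 388); the contour letter lists are node 5's `Beta.AveragingContours` (`gammaC`, `loopC`, `segUp`, `linAvg`),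
used BY NAME).
* B7 p.19 (14) «Ā_c = Σ_{x∈B(c_−)} L^{−(d+1)}(A(Γ_{c_−,x}) + A([x, x(c)]) + A(Γ_{x(c),c_+}))», «Let us notice that
  Γ_{c_−,x}∪[x, x(c)]∪Γ_{x(c),c_+} is an oriented contour with c_− as an initial point and c_+ as a final point. We
  denote it by Γ_{c,x}.», (15) «We define Ū_c = exp[i Σ_{x∈B(c_−)} L^{−d} (1/i) log U(Γ_{c,x})U(c)^{−1}] U(c).» (the
  same display is (42) of Sect. B, p.23), (11) «Ū^u = (Ū)^u.»; p.20: «It is easy to see that taking U = e^{iA} with A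
  small and expanding the logarithm of the expression on the right-hand side above in powers of A, we get the
  expression (14) as a linear term in the expansion.», «Another important property is an analyticity of a result of
  the averaging operation with respect to an averaged field.»
* B9 p.392 (3.12) «A^η(exp iηAU) = A^η(U) + ⟨A, J⟩ + ½⟨A, ΔA⟩ + ⋯» (the fluctuation multiplies the background on the
  LEFT), (3.13) «Q_j(U, ηA) = (1/i) log (exp iηA)‾‾^j»; p.393 (3.14) «(1/(L^jη)) Q_j(U, ηA) = Q_j(U)A + (1/(L^jη))
  C_j(U, L^jηA), where Q_j(U)A is a linear part of the function (3.13) and C_j(U, A) is an analytic function of A whose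
  expansion begins with second order terms.», (3.15) «Q_j(U) = Q(Ū^{j−1})·…·Q(Ū)Q(U)».
Nothing printed is asserted.  In particular the sentence of B7 p.20 quoted above («we get the expression (14) as a
linear term») is NOT cited: its content at `U = 1` is THEOREM P below, kernel-proved in the precise ray-jet form
stated there; the second-order statements (THEOREMS A, B, H) are not printed in closed form anywhere in B7/B9 (B9
(3.14) only names «C_j … begins with second order terms») — they are this package's [folklore] computation, the one
an2's one-loop bookkeeping consumes ((b1)/(b2) of his request, journal 2026-08-19T12:58:03Z item (B)).

WHAT IS TYPED.  Letters live in a complete normed algebra `𝔸` over `𝕜 = ℝ or ℂ` (`RCLike 𝕜`), colour-free as in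
nodes 2–7a (the physical case is `𝔸 = M_N(ℂ)`, `W_f, B_f ∈ 𝔲(N)`; no `i`'s: Bałaban's `e^{iηA}` is our `e^{W}`).
Mathlib has no Banach-algebra logarithm, so — exactly as node 4b `Beta.LogHolonomySecondJet` does for one holonomy —
a «local logarithm» of a curve `F` is ANY curve `Y` with `exp (Y r) = F r` for `r` near `0` together with an additive
two-jet `Y r = r•S + r²•Q + o(r²)` (`AddJet Y S Q`, §1); the theorems COMPUTE `(S, Q)` (jets are unique, §1
`MulJet.unique`); they do not construct `Y`.  Fix a coarse bond `b = (μ, y)` at scale `L ≥ 1`, its fine image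
`c = segUp _ (L•y) μ L`, the block points `x = L•y + b′`, `b′ ∈ box d L`, and node 5's closed loops
`loop_x = Γ_{b,x} ∪ (−c)` (`loopC`).  Along the two-parameter ray of the PRODUCT CHART `U_f(r) = e^{rσW_f}·e^{rτB_f}`
(fluctuation `W` LEFT of background `B`, as in (3.12)/(3.13); a backward bond contributes
`U_f(r)⁻¹ = e^{−rτB_f}e^{−rσW_f}`) the parallel transport `U(loop_x)(r)` is node 2's `holPath` of the DOUBLED letter
list `loopLetters σ τ W B L μ y b′` (§2, §5: each oriented letter `((W_f, B_f), +1)` / `−((W_f, B_f), +1)` of node 5's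
list of the oriented pair form `opForm W B` becomes the two letters `σW_f, τB_f` — forward — or `−τB_f, −σW_f` —
backward), and `U(c)(r) = holPath (cLetters σ τ W B L μ y) r`.  The display (42) at `U(r)` is then the curve
  `F_{σ,τ}(r) := exp( L^{−d} • Σ_{b′ ∈ box d L} Y_{b′}(r) ) · holPath (cLetters σ τ W B L μ y) r`,
  `exp (Y_{b′} r) = holPath (loopLetters σ τ W B L μ y b′) r` near `0`, `AddJet (Y_{b′}) (S_{b′}) (Q_{b′})`,
with `Y_{b′}` local logarithms of the loop holonomies — HYPOTHESES of every theorem, together with their jets.  Write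
`Z_X := linAvg X L μ y` (node 5; `= L^{d+1}·X̄_b` of (14)), and `hessU`, `vhU`, `[W,B]_bw = bw W B` for node 7a's
functionals (`Beta.AveragingHessianKernels`, BY NAME).  THE THEOREMS (all [folklore]; §4–§6):
* ENGINE (`engine`, §4): for any finite family of lists `ℓ_i` with local logarithms `Y_i` of `holPath ℓ_i` and a list
  `ℓ_c`, the curve `t ↦ exp(c • Σ_i Y_i t) · holPath ℓ_c t` has the multiplicative two-jet `1 + tP + t²R + o(t²)` with
  `P = c•Σ_i Σℓ_i + Σℓ_c`, `R = ½(c•Σ_i commSum ℓ_i + commSum ℓ_c + [c•Σ_i Σℓ_i, Σℓ_c]) + ½P²` (`commSum` = node 2's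
  ordered commutator sum) — node 4b's `log_holPath_jets` per loop, `exp` of an additive jet (`AddJet.mulJet_exp`, from
  node 4b's `exp_comp_taylor_isLittleO`), node 4b's `holPath_taylor_isBigO`, and the product rule `MulJet.mul`.
* THEOREM P (`rayJets_pure`; the pure fluctuation ray `U_f = e^{rW_f}`, node 5's lists `loopC W`, `segUp W`
  verbatim): every local logarithm `Ψ` of `F` with `AddJet Ψ p q` has `L^d • p = Z_W` — (14) IS the linear term —
  and `(4L^d) • q = hessU W W`.
* THEOREM A (`rayJets`, `rayJets_smul`; the product-chart ray): `L^d • p = σ•Z_W + τ•Z_B` and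
  `(4L^d) • q = σ²•hessU W W + τ²•hessU B B + 2στ•(hessU W B + Z_{[W,B]_bw})`; the `στ` term carries the
  ORIENTATION-CORRECT same-bond contacts `Z_{[W,B]_bw}` (§3 `dsum_loopC`: a forward bond's block `σW_f, τB_f` has
  ordered commutator `[σW_f, τB_f] = στ[W_f, B_f]`, a backward bond's block `−τB_f, −σW_f` has
  `[−τB_f, −σW_f] = −στ[W_f, B_f]` — in both cases `στ` times the value of the ONE-FORM `[W,B]_bw` on the oriented
  bond as node 5 reads it, which is why the contacts enter through `linAvg` and not as commutators of negated letters).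
* THEOREM B (`vhJets`, `vhJets_smul`; THE RE-CENTRED (V-H) STENCIL, an2's (b1); B7 p.28 names the right-trivialised
  function «(1/i) log (V′V₀)‾_c(V̄₀)_c^{−1}»): for `G(r) := F_{σ,τ}(r) · F_{0,τ}(r)⁻¹`, the inverse written
  log-free as `holPath (invPath (cLetters 0 τ …)) r · exp(−L^{−d} • Σ Y⁰_{b′}(r))` (node 3's `invPath`,
  `holPath_mul_inv`; `Y⁰` local logarithms along the pure-background ray), every local logarithm `Φ` of `G` with
  `AddJet Φ a b₂` has `L^d • a = σ•Z_W` and `(4L^{2d}) • b₂ = σ²•(L^d • hessU W W) + 2στ • vhU W B`; the mechanism is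
  the quotient lemma `MulJet.log_jets_of_mul_inv` (Baker–Campbell–Hausdorff to second order, log-free:
  `b₂ = q − q⁰ − ½[p, p⁰]`), whose commutator is node 7a's `−[Z_W, Z_B]` term of `vhU`.
* THEOREM H (`rayJets_polarised`; an2's (b2), polarised): along `U_f = e^{r(sW_f + s′W′_f)}`,
  `(4L^d) • q = s²•hessU W W + 2ss′•hessU W W′ + s′²•hessU W′ W′` — THEOREM P for the form `s•W + s′•W′` and the
  algebraic polarisation identity `hessU_linComb_self` (§6, from the scalar polarisation `commSum_map_polHom` of node
  2's `commSum`, node 7a's `cross`).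
* SINGLE-BOND COROLLARIES (`vhJets_single`, `rayJets_polarised_single`): for `W = single f w`, `B = single f′ v`,
  `W′ = single f′ w′` (node 7a §3): `(4L^{2d}) • b₂ = 2στ • (vhCount_b(f,f′) • [w, v])` and
  `(4L^d) • q = 2ss′ • (hessCount_b(f,f′) • [w, w′])` — node 7a's integer kernels ARE the second-order coefficients;
  this is the identification node 7a's header defers to this leaf («identification: node 7b»), for its
  `hessKer`/`hessFF` ((b2)) and `vhKer`/`vhS` ((b1), product chart) packings.
NORMALISATION, stated once (re node 7a's XREAD, lit3-g20 D1): `p, q, a, b₂` are Taylor COEFFICIENTS (`Y r = r•S +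
r²•Q + o(r²)`), so second derivatives in `r` are `2q`, `2b₂`.  With node 7a's `H_b(W,W′) := hessU W W′/(2L^d)` and
`M_b(W;B) := vhU W B/(2L^{2d})`: THEOREM H reads `q = ½s²·H_b(W,W) + ss′·H_b(W,W′) + ½s′²·H_b(W′,W′)` and
THEOREM B reads `b₂ = ½σ²·H_b(W,W) + στ·M_b(W;B)`; hence, whenever a C² two-variable local logarithm exists (not
constructed here), `∂_s∂_{s′}|₀ log Φ_b(e^{sW+s′W′}) = H_b(W,W′)` and
`∂_σ∂_τ|₀ log[Φ_b(e^{σW}e^{τB})Φ_b(e^{τB})⁻¹] = M_b(W;B)`, which are the two sentences of node 7a's header.  THE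
CONSUMER'S CHART (an2 ANSWER, journal l.53795, 2026-08-19): «PRODUCT chart, minimiser-centred, fluctuation LEFT
(U = e^{W}e^{B}) ⇒ (b1) := m_b = `vhS`; (b2) = `hessFF`; … Haar clause is an2/lead's» — THEOREM B is stated in exactly
that chart (`W` left; re-centred on the RIGHT by the pure-background averaging: `G = F_{σ,τ}·F_{0,τ}⁻¹`).

WHAT IS NOT TYPED HERE (scope).  (i) Existence, uniqueness-as-a-function or analyticity of the logarithm in (15)/(42)
(B7 p.20 «analyticity»; the small-field conditions under which `log` is the principal branch): local logarithms and
their jets are HYPOTHESES; the Haar/analyticity clauses are an2's / the lead's.  (ii) Two-variable calculus: only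
ray jets and the polarisation ALGEBRA are typed; mixed partial derivatives as such are the reading above, not a theorem
here.  (iii) Rays start at the trivial configuration `U = 1`; the `R(U₀)`-dressed (89)–(92) operation of B9 (3.13) at
`U₀ ≠ 1` and the `j`-fold compositions (3.15) are nodes 4/7a ((b4) chain rule `Beta.AveragingHessianKernels` §8)
business.  (iv) Nothing about `FlowStep.BetaPertH` itself: this leaf is one INPUT of an2's one-loop bookkeeping (the
identification behind (b1)/(b2)), not a discharge, not summit progress, NOT the continuum limit, NOT Clay.

MODULE MAP.  §1 (`Jets`) the two-jet calculus at `0`: `AddJet`, `MulJet`, linear structure, `MulJet.mul`,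
`MulJet.unique` (node 4b's `eq_zero_of_linear_quadratic_isLittleO`), `AddJet.mulJet_exp`, `mulJet_holPath`, THE LOG
LEMMA `AddJet.jets_of_exp_eq`.  §2 (`Doubled`) oriented pair letters `((w,b), ±1)`, `dbl σ τ`, `dterm`/`dsum`,
`sum_dbl`, `commSum_dbl`.  §3 (`Bridges`) `opForm`, projections to node 5's lists of `W`, `B`, node 6's `pairForm W B`,
orientation-correctness `dsum_loopC`/`dsum_segUp`, `cross_loopC_pairForm_self`, `sum_box_sum_loopC`.  §4 (`Engine`)
scalar bookkeeping, THE QUOTIENT LEMMA `MulJet.log_jets_of_mul_inv` / `AddJet.jets_of_exp_eq_mul_inv`,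
`log_holPath_addJet`, `engine`.  §5 (`Rays`) `loopLetters`, `cLetters`, their sums / commutator sums / block sums,
`hessU`/`vhU` over `𝕜`-scalars, `rayP`, `rayQ`, THEOREMS P, A, B and `vhJets_single`.  §6 (`Polarisation`) `polHom`,
`commSum_map_polHom`, `linAvg_linComb`, `hessU_linComb_self`, THEOREM H and `rayJets_polarised_single`.
-/

namespace Literature.MathematicalPhysics.QuantumFieldTheory.Balaban1983to89.Beta.AveragingHessianJets

open NormedSpace Filter Topology Asymptotics
open Literature.MathematicalPhysics.QuantumFieldTheory.Balaban1983to89.Beta.TransportVertices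
  (commSum commSum_nil commSum_cons holonomy holPath holPath_cons holPath_nil quad two_smul_quad)
open Literature.MathematicalPhysics.QuantumFieldTheory.Balaban1983to89.Beta.LogHolonomySecondJet
open Literature.MathematicalPhysics.QuantumFieldTheory.Balaban1983to89.Beta.AffineAveraging
open Literature.MathematicalPhysics.QuantumFieldTheory.Balaban1983to89.Beta.AveragingContours
open Literature.MathematicalPhysics.QuantumFieldTheory.Balaban1983to89.Beta.TransportedContourVariables
open Literature.MathematicalPhysics.QuantumFieldTheory.Balaban1983to89.Beta.AdjointTransportJets
  (invPath holPath_mul_inv)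
open Literature.MathematicalPhysics.QuantumFieldTheory.Balaban1983to89.Beta.AveragingHessianKernels

noncomputable section

/-! ## §1 A two-jet calculus at `0` (log-free) -/

section Jets

variable {𝕜 : Type*} [RCLike 𝕜] {𝔸 : Type*} [NormedRing 𝔸] [NormedAlgebra 𝕜 𝔸]

/-- [folklore] ADDITIVE two-jet at `0`: `Y t = t•S + t²•Q + o(t²)` (the shape of a local logarithm). -/
def AddJet (Y : 𝕜 → 𝔸) (S Q : 𝔸) : Prop :=
  (fun t => Y t - t • S - t ^ 2 • Q) =o[𝓝 (0 : 𝕜)] fun t => t ^ 2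

/-- [folklore] MULTIPLICATIVE two-jet at `0` (expansion about `1`): `F t = 1 + t•P + t²•R + o(t²)`. -/
def MulJet (F : 𝕜 → 𝔸) (P R : 𝔸) : Prop :=
  (fun t => F t - 1 - t • P - t ^ 2 • R) =o[𝓝 (0 : 𝕜)] fun t => t ^ 2

/-! ### Elementary asymptotic bookkeeping at `𝓝 0` -/

/-- [folklore] `t•S = O(t)`. -/
theorem isBigO_smul_const (S : 𝔸) : (fun t : 𝕜 => t • S) =O[𝓝 (0 : 𝕜)] fun t => t :=
  IsBigO.of_bound ‖S‖ (Eventually.of_forall fun t => by rw [norm_smul, mul_comm])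

/-- [folklore] `t²•Q = O(t²)`. -/
theorem isBigO_sq_smul_const (Q : 𝔸) : (fun t : 𝕜 => t ^ 2 • Q) =O[𝓝 (0 : 𝕜)] fun t => t ^ 2 :=
  IsBigO.of_bound ‖Q‖ (Eventually.of_forall fun t => by rw [norm_smul, mul_comm])

/-- [folklore] `t² = O(t)` at `0`. -/
theorem isBigO_sq_self : (fun t : 𝕜 => t ^ 2) =O[𝓝 (0 : 𝕜)] fun t => t :=
  (isLittleO_pow_pow (𝕜 := 𝕜) one_lt_two).isBigO.congr_right fun t => by simp

/-- [folklore] `t³ = o(t²)` at `0`. -/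
theorem isLittleO_cube_sq : (fun t : 𝕜 => t ^ 3) =o[𝓝 (0 : 𝕜)] fun t => t ^ 2 :=
  isLittleO_pow_pow (by norm_num)

/-- [folklore] `t⁴ = o(t²)` at `0`. -/
theorem isLittleO_four_sq : (fun t : 𝕜 => t ^ 4) =o[𝓝 (0 : 𝕜)] fun t => t ^ 2 :=
  isLittleO_pow_pow (by norm_num)

/-- [folklore] `t = O(1)` at `0`. -/
theorem isBigO_self_one : (fun t : 𝕜 => t) =O[𝓝 (0 : 𝕜)] fun _ => (1 : 𝕜) := by
  refine IsBigO.of_bound 1 ?_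
  filter_upwards [Metric.closedBall_mem_nhds (0 : 𝕜) one_pos] with t ht
  simpa [dist_zero_right] using ht

/-! ### Additive jets: linear structure -/

/-- [folklore] The exact linear curve `t ↦ t•S` has jet `(S, 0)`. -/
theorem addJet_linear (S : 𝔸) : AddJet (fun t : 𝕜 => t • S) S 0 := by
  simp only [AddJet, sub_self, smul_zero]
  exact isLittleO_zero _ _

/-- [folklore] Jets add. -/
theorem AddJet.add {Y₁ Y₂ : 𝕜 → 𝔸} {S₁ Q₁ S₂ Q₂ : 𝔸} (h₁ : AddJet Y₁ S₁ Q₁) (h₂ : AddJet Y₂ S₂ Q₂) :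
    AddJet (fun t => Y₁ t + Y₂ t) (S₁ + S₂) (Q₁ + Q₂) :=
  (IsLittleO.add h₁ h₂).congr_left fun t => by simp only [smul_add]; abel

/-- [folklore] Jets negate. -/
theorem AddJet.neg {Y : 𝕜 → 𝔸} {S Q : 𝔸} (h : AddJet Y S Q) : AddJet (fun t => -Y t) (-S) (-Q) :=
  (IsLittleO.neg_left h).congr_left fun t => by simp only [smul_neg]; abel

/-- [folklore] Jets scale. -/
theorem AddJet.smul {Y : 𝕜 → 𝔸} {S Q : 𝔸} (h : AddJet Y S Q) (c : 𝕜) :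
    AddJet (fun t => c • Y t) (c • S) (c • Q) :=
  (IsLittleO.const_smul_left h c).congr_left fun t => by simp only [Pi.smul_apply, smul_sub, smul_comm c]

/-- [folklore] Finite sums of jets. -/
theorem AddJet.sum {ι : Type*} (s : Finset ι) {Y : ι → 𝕜 → 𝔸} {S Q : ι → 𝔸}
    (h : ∀ i ∈ s, AddJet (Y i) (S i) (Q i)) :
    AddJet (fun t => ∑ i ∈ s, Y i t) (∑ i ∈ s, S i) (∑ i ∈ s, Q i) :=
  (IsLittleO.sum h).congr_left fun t => by
    simp only [Finset.smul_sum, ← Finset.sum_sub_distrib]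

/-- [folklore] A curve with a two-jet is `O(t)` … -/
theorem AddJet.isBigO {Y : 𝕜 → 𝔸} {S Q : 𝔸} (h : AddJet Y S Q) : Y =O[𝓝 (0 : 𝕜)] fun t => t := by
  have h1 : (fun t => Y t - t • S) =O[𝓝 (0 : 𝕜)] fun t => t ^ 2 :=
    ((IsLittleO.isBigO h).add (isBigO_sq_smul_const Q)).congr_left fun t => by simp only [sub_add_cancel]
  exact ((h1.trans isBigO_sq_self).add (isBigO_smul_const S)).congr_left fun t => by
    simp only [sub_add_cancel]

/-- [folklore] … and in particular tends to `0`. -/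
theorem AddJet.tendsto_zero {Y : 𝕜 → 𝔸} {S Q : 𝔸} (h : AddJet Y S Q) : Tendsto Y (𝓝 0) (𝓝 0) :=
  h.isBigO.trans_tendsto tendsto_id

/-- [folklore] `Y − t•S = O(t²)`. -/
theorem AddJet.isBigO_sub {Y : 𝕜 → 𝔸} {S Q : 𝔸} (h : AddJet Y S Q) :
    (fun t => Y t - t • S) =O[𝓝 (0 : 𝕜)] fun t => t ^ 2 :=
  ((IsLittleO.isBigO h).add (isBigO_sq_smul_const Q)).congr_left fun t => by simp only [sub_add_cancel]

/-- [folklore] The square of a curve with a two-jet: `Y·Y = t²•S² + o(t²)`. -/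
theorem AddJet.sq {Y : 𝕜 → 𝔸} {S Q : 𝔸} (h : AddJet Y S Q) :
    (fun t => Y t * Y t - t ^ 2 • (S * S)) =o[𝓝 (0 : 𝕜)] fun t => t ^ 2 := by
  have hYS := h.isBigO_sub
  have hYO := h.isBigO
  have hS1 := isBigO_smul_const (𝕜 := 𝕜) S
  have h1 : (fun t => (Y t - t • S) * Y t) =O[𝓝 (0 : 𝕜)] fun t => t ^ 2 * t := hYS.mul hYO
  have h2 : (fun t => (t • S) * (Y t - t • S)) =O[𝓝 (0 : 𝕜)] fun t => t * t ^ 2 := hS1.mul hYS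
  have h3 : (fun t => (Y t - t • S) * Y t + (t • S) * (Y t - t • S)) =O[𝓝 (0 : 𝕜)] fun t => t ^ 3 :=
    (h1.congr (fun t => rfl) (fun t => by ring)).add (h2.congr (fun t => rfl) (fun t => by ring))
  refine (h3.trans_isLittleO isLittleO_cube_sq).congr_left fun t => ?_
  simp only [sub_mul, mul_sub, smul_mul_assoc, mul_smul_comm, smul_smul, pow_two]
  abel

/-! ### Multiplicative jets -/

/-- [folklore] `F − 1 = O(t)`. -/
theorem MulJet.isBigO_sub_one {F : 𝕜 → 𝔸} {P R : 𝔸} (h : MulJet F P R) :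
    (fun t => F t - 1) =O[𝓝 (0 : 𝕜)] fun t => t := by
  have h1 : (fun t => F t - 1 - t • P) =O[𝓝 (0 : 𝕜)] fun t => t ^ 2 :=
    ((IsLittleO.isBigO h).add (isBigO_sq_smul_const R)).congr_left fun t => by simp only [sub_add_cancel]
  exact ((h1.trans isBigO_sq_self).add (isBigO_smul_const P)).congr_left fun t => by
    simp only [sub_add_cancel]

/-- [folklore] `F = O(1)`. -/
theorem MulJet.isBigO_one {F : 𝕜 → 𝔸} {P R : 𝔸} (h : MulJet F P R) :
    F =O[𝓝 (0 : 𝕜)] fun _ => (1 : 𝕜) := by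
  have h1 : (fun t => F t - 1) =O[𝓝 (0 : 𝕜)] fun _ => (1 : 𝕜) := h.isBigO_sub_one.trans isBigO_self_one
  have h2 : (fun _ : 𝕜 => (1 : 𝔸)) =O[𝓝 (0 : 𝕜)] fun _ => (1 : 𝕜) :=
    isBigO_const_const (1 : 𝔸) one_ne_zero _
  exact (h1.add h2).congr_left fun t => by simp only [sub_add_cancel]

/-- [folklore] Eventually-equal functions have the same multiplicative jets (transport). -/
theorem MulJet.congr {F G : 𝕜 → 𝔸} {P R : 𝔸} (h : MulJet F P R) (hFG : ∀ᶠ t in 𝓝 (0 : 𝕜), F t = G t) :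
    MulJet G P R :=
  h.congr' (hFG.mono fun t ht => show F t - 1 - t • P - t ^ 2 • R = G t - 1 - t • P - t ^ 2 • R by rw [ht])
    EventuallyEq.rfl

/-- [folklore] UNIQUENESS of multiplicative jets. -/
theorem MulJet.unique {F : 𝕜 → 𝔸} {P R P' R' : 𝔸} (h : MulJet F P R) (h' : MulJet F P' R') :
    P = P' ∧ R = R' := by
  have hd : (fun t : 𝕜 => t • (P' - P) + t ^ 2 • (R' - R)) =o[𝓝 (0 : 𝕜)] fun t => t ^ 2 :=
    (h.sub h').congr_left fun t => by simp only [smul_sub]; abel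
  obtain ⟨h1, h2⟩ := eq_zero_of_linear_quadratic_isLittleO hd
  exact ⟨(sub_eq_zero.mp h1).symm, (sub_eq_zero.mp h2).symm⟩

/-- [folklore] The constant `1` has jet `(0, 0)`. -/
theorem mulJet_one : MulJet (fun _ : 𝕜 => (1 : 𝔸)) 0 0 := by
  simp only [MulJet, sub_self, smul_zero]
  exact isLittleO_zero _ _

/-- [folklore] PRODUCTS: `(1 + tP + t²R + o)(1 + tP′ + t²R′ + o) = 1 + t(P+P′) + t²(R + R′ + PP′) + o(t²)`. -/
theorem MulJet.mul {F G : 𝕜 → 𝔸} {P R P' R' : 𝔸} (hF : MulJet F P R) (hG : MulJet G P' R') :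
    MulJet (fun t => F t * G t) (P + P') (R + R' + P * P') := by
  have hGO := hG.isBigO_one
  -- term 1: (F − 1 − tP − t²R)·G = o(t²)·O(1)
  have h1 : (fun t => (F t - 1 - t • P - t ^ 2 • R) * G t) =o[𝓝 (0 : 𝕜)] fun t => t ^ 2 * (1 : 𝕜) :=
    hF.mul_isBigO hGO
  -- term 2: (1 + tP + t²R)·(G − 1 − tP′ − t²R′) = O(1)·o(t²)
  have hpoly : (fun t : 𝕜 => (1 : 𝔸) + t • P + t ^ 2 • R) =O[𝓝 (0 : 𝕜)] fun _ => (1 : 𝕜) := by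
    have : MulJet (fun t : 𝕜 => (1 : 𝔸) + t • P + t ^ 2 • R) P R := by
      exact (isLittleO_zero _ _).congr_left fun t => by beta_reduce; module
    exact this.isBigO_one
  have h2 : (fun t => ((1 : 𝔸) + t • P + t ^ 2 • R) * (G t - 1 - t • P' - t ^ 2 • R'))
      =o[𝓝 (0 : 𝕜)] fun t => (1 : 𝕜) * t ^ 2 := hpoly.mul_isLittleO hG
  -- term 3: the cubic and quartic leftovers
  have h3 : (fun t : 𝕜 => t ^ 3 • (P * R' + R * P') + t ^ 4 • (R * R')) =o[𝓝 (0 : 𝕜)] fun t => t ^ 2 := by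
    refine IsLittleO.add ?_ ?_
    · exact ((isLittleO_cube_sq (𝕜 := 𝕜)).smul_isBigO
        (isBigO_const_const (P * R' + R * P') (one_ne_zero (α := 𝕜)) _)).congr
          (fun t => rfl) (fun t => by simp)
    · exact ((isLittleO_four_sq (𝕜 := 𝕜)).smul_isBigO
        (isBigO_const_const (R * R') (one_ne_zero (α := 𝕜)) _)).congr
          (fun t => rfl) (fun t => by simp)
  have h12 := (h1.congr_right fun t => mul_one (t ^ 2)).add (h2.congr_right fun t => one_mul (t ^ 2))
  refine (h12.add h3).congr_left fun t => ?_
  simp only [sub_mul, mul_sub, add_mul, one_mul, mul_one, smul_mul_assoc, mul_smul_comm, smul_smul,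
    smul_add]
  ring_nf
  abel

/-! ### The exponential of an additive jet, the holonomy path, and the LOG lemma -/

section Exp

variable [CompleteSpace 𝔸]

/-- [folklore] `exp (t•S + t²•Q + o(t²)) = 1 + t•S + t²•(Q + ½S²) + o(t²)`. -/
theorem AddJet.mulJet_exp {Y : 𝕜 → 𝔸} {S Q : 𝔸} (h : AddJet Y S Q) :
    MulJet (fun t => exp (Y t)) S (Q + (2 : 𝕜)⁻¹ • (S * S)) := by
  have hE := exp_comp_taylor_isLittleO 𝕜 h.isBigO h.tendsto_zero
  have hsq : (fun t => (2 : 𝕜)⁻¹ • (Y t * Y t - t ^ 2 • (S * S))) =o[𝓝 (0 : 𝕜)] fun t => t ^ 2 :=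
    (h.sq.const_smul_left ((2 : 𝕜)⁻¹)).congr_left fun t => rfl
  refine ((hE.add h).add hsq).congr_left fun t => ?_
  simp only [smul_sub, smul_add, smul_smul]
  module

/-- [folklore] The holonomy path `Π_j e^{t b_j}` has multiplicative jet `(Σ l, quad l)` (an2's tail, node 4b). -/
theorem mulJet_holPath (l : List 𝔸) : MulJet (holPath 𝕜 l) l.sum (quad 𝕜 l) :=
  (holPath_taylor_isBigO 𝕜 l).trans_isLittleO isLittleO_cube_sq

/-- [folklore] THE LOG LEMMA (log-free): if `Ψ` has an additive two-jet `(p, q)` and `exp ∘ Ψ = F` near `0`, where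
`F = 1 + tP + t²R + o(t²)`, then `p = P` and `q = R − ½P²`.  (Node 4b's `log_holPath_jets` is the case
`F = holPath l`.) -/
theorem AddJet.jets_of_exp_eq {Ψ F : 𝕜 → 𝔸} {p q P R : 𝔸} (hΨ : AddJet Ψ p q) (hF : MulJet F P R)
    (h : ∀ᶠ t in 𝓝 (0 : 𝕜), exp (Ψ t) = F t) : p = P ∧ q = R - (2 : 𝕜)⁻¹ • (P * P) := by
  obtain ⟨h1, h2⟩ := ((AddJet.mulJet_exp hΨ).congr h).unique hF
  refine ⟨h1, ?_⟩
  rw [← h2, ← h1, add_sub_cancel_right]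

/-- [folklore] SANITY: node 4b's matching theorem is the special case `F = holPath l`. -/
example (l : List 𝔸) {Y : 𝕜 → 𝔸} {S' Q' : 𝔸} (hY : AddJet Y S' Q')
    (hlog : ∀ᶠ t in 𝓝 (0 : 𝕜), exp (Y t) = holPath 𝕜 l t) :
    S' = l.sum ∧ Q' = quad 𝕜 l - (2 : 𝕜)⁻¹ • (S' * S') := by
  obtain ⟨h1, h2⟩ := hY.jets_of_exp_eq (mulJet_holPath l) hlog
  exact ⟨h1, h1 ▸ h2⟩

end Exp

end Jets

/-! ## §2 Oriented pair letters and the DOUBLED letter lists of the product chart -/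

section Doubled

variable {𝕜 : Type*} [RCLike 𝕜] {𝔸 : Type*} [NormedRing 𝔸] [NormedAlgebra 𝕜 𝔸]

/-- [folklore] `𝕜`-scalars pull out of a commutator: `[σ•a, τ•b] = (στ)•[a, b]`. -/
theorem comm_smul_smul (σ τ : 𝕜) (a b : 𝔸) : comm (σ • a) (τ • b) = (σ * τ) • comm a b := by
  simp only [AveragingHessianKernels.comm, smul_mul_smul_comm, mul_comm τ σ, smul_sub]

/-- [folklore] `[σ•a, b] = σ•[a, b]`. -/
theorem comm_smul_left (σ : 𝕜) (a b : 𝔸) : comm (σ • a) b = σ • comm a b := by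
  simp only [AveragingHessianKernels.comm, smul_mul_assoc, mul_smul_comm, smul_sub]

/-- [folklore] `[a, τ•b] = τ•[a, b]`. -/
theorem comm_smul_right (τ : 𝕜) (a b : 𝔸) : comm a (τ • b) = τ • comm a b := by
  simp only [AveragingHessianKernels.comm, smul_mul_assoc, mul_smul_comm, smul_sub]

/-- [folklore] FIRST letter of the two-letter block of an oriented pair letter `q = ((w, b), ε)` along the ray
`U_f = e^{rσW_f} e^{rτB_f}`: forward (`ε = 1`) the block is `[σw, τb]`, backward (node 5 stores `((−w,−b), −1)`)
it is `[τ·(−b), σ·(−w)]` = the letters of `(e^{rσw}e^{rτb})⁻¹ = e^{−rτb}e^{−rσw}`. -/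
def fstL (σ τ : 𝕜) (q : (𝔸 × 𝔸) × ℤ) : 𝔸 := if q.2 = 1 then σ • q.1.1 else τ • q.1.2

/-- [folklore] SECOND letter of the block (see `fstL`). -/
def sndL (σ τ : 𝕜) (q : (𝔸 × 𝔸) × ℤ) : 𝔸 := if q.2 = 1 then τ • q.1.2 else σ • q.1.1

/-- [folklore] THE DOUBLED LETTER LIST: each oriented pair letter replaced by its two-letter block, in order. -/
def dbl (σ τ : 𝕜) : List ((𝔸 × 𝔸) × ℤ) → List 𝔸
  | [] => []
  | q :: l => fstL σ τ q :: sndL σ τ q :: dbl σ τ l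

/-- [folklore] `dbl [] = []`. -/
@[simp] theorem dbl_nil (σ τ : 𝕜) : dbl σ τ ([] : List ((𝔸 × 𝔸) × ℤ)) = [] := rfl

/-- [folklore] The recursion of `dbl`. -/
@[simp] theorem dbl_cons (σ τ : 𝕜) (q : (𝔸 × 𝔸) × ℤ) (l : List ((𝔸 × 𝔸) × ℤ)) :
    dbl σ τ (q :: l) = fstL σ τ q :: sndL σ τ q :: dbl σ τ l := rfl

/-- [folklore] The IN-BLOCK commutator of an oriented pair letter, orientation-correct: `[w, b]` forward,
`[−b, −w] = [b, w]` backward (as stored: `[q.1.2, q.1.1]`). -/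
def dterm (q : (𝔸 × 𝔸) × ℤ) : 𝔸 := if q.2 = 1 then comm q.1.1 q.1.2 else comm q.1.2 q.1.1

/-- [folklore] The sum of the in-block commutators along a list. -/
def dsum (l : List ((𝔸 × 𝔸) × ℤ)) : 𝔸 := (l.map dterm).sum

/-- [folklore] `dsum [] = 0`. -/
@[simp] theorem dsum_nil : dsum ([] : List ((𝔸 × 𝔸) × ℤ)) = 0 := rfl

/-- [folklore] The recursion of `dsum`. -/
@[simp] theorem dsum_cons (q : (𝔸 × 𝔸) × ℤ) (l : List ((𝔸 × 𝔸) × ℤ)) : dsum (q :: l) = dterm q + dsum l := by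
  simp [dsum]

/-- [folklore] The projection onto the FIRST (fluctuation) letter. -/
def πW : ((𝔸 × 𝔸) × ℤ) →+ 𝔸 := (AddMonoidHom.fst 𝔸 𝔸).comp (AddMonoidHom.fst (𝔸 × 𝔸) ℤ)

/-- [folklore] The projection onto the SECOND (background) letter. -/
def πB : ((𝔸 × 𝔸) × ℤ) →+ 𝔸 := (AddMonoidHom.snd 𝔸 𝔸).comp (AddMonoidHom.fst (𝔸 × 𝔸) ℤ)

/-- [folklore] The projection onto the letter PAIR (orientation flag forgotten). -/
def πP : ((𝔸 × 𝔸) × ℤ) →+ 𝔸 × 𝔸 := AddMonoidHom.fst (𝔸 × 𝔸) ℤ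

/-- [folklore] `πW q = q.1.1`. -/
@[simp] theorem πW_apply (q : (𝔸 × 𝔸) × ℤ) : πW q = q.1.1 := rfl

/-- [folklore] `πB q = q.1.2`. -/
@[simp] theorem πB_apply (q : (𝔸 × 𝔸) × ℤ) : πB q = q.1.2 := rfl

/-- [folklore] `πP q = q.1`. -/
@[simp] theorem πP_apply (q : (𝔸 × 𝔸) × ℤ) : πP q = q.1 := rfl

/-- [folklore] The background projection of the pair list is the background letter list. -/
theorem bg_map_πP (l : List ((𝔸 × 𝔸) × ℤ)) : bg (l.map πP) = l.map πW := by
  simp [bg, List.map_map, Function.comp_def]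

/-- [folklore] The fluctuation projection of the pair list is the second letter list. -/
theorem fl_map_πP (l : List ((𝔸 × 𝔸) × ℤ)) : fl (l.map πP) = l.map πB := by
  simp [fl, List.map_map, Function.comp_def]

/-- [folklore] The two letters of a block sum to `σ•w + τ•b` in either orientation. -/
theorem fstL_add_sndL (σ τ : 𝕜) (q : (𝔸 × 𝔸) × ℤ) : fstL σ τ q + sndL σ τ q = σ • q.1.1 + τ • q.1.2 := by
  unfold fstL sndL; split_ifs <;> abel

/-- [folklore] The in-block commutator: `[fstL, sndL] = (στ)•dterm` in either orientation. -/
theorem comm_fstL_sndL (σ τ : 𝕜) (q : (𝔸 × 𝔸) × ℤ) :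
    comm (fstL σ τ q) (sndL σ τ q) = (σ * τ) • dterm q := by
  unfold fstL sndL dterm; split_ifs <;> simp only [comm_smul_smul, mul_comm τ σ]

/-- [folklore] LETTER SUM of the doubled list: `Σ dbl = σ•Σw + τ•Σb`. -/
theorem sum_dbl (σ τ : 𝕜) (l : List ((𝔸 × 𝔸) × ℤ)) :
    (dbl σ τ l).sum = σ • (l.map πW).sum + τ • (l.map πB).sum := by
  induction l with
  | nil => simp
  | cons q l ih =>
    rw [dbl_cons, List.sum_cons, List.sum_cons, ← add_assoc, fstL_add_sndL, ih]
    simp only [List.map_cons, List.sum_cons, πW_apply, πB_apply, smul_add]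
    abel

/-- [folklore] ORDERED COMMUTATOR SUM of the doubled list (the second-order bookkeeping of the product chart):
`commSum (dbl σ τ l) = σ²·commSum(w) + τ²·commSum(b) + στ·(cross(w,b) + dsum l)` — the `στ` part is the polarised
cross sum of node 7a PLUS the orientation-correct in-block contacts. -/
theorem commSum_dbl (σ τ : 𝕜) (l : List ((𝔸 × 𝔸) × ℤ)) :
    commSum (dbl σ τ l) = σ ^ 2 • commSum (l.map πW) + τ ^ 2 • commSum (l.map πB)
      + (σ * τ) • (cross (l.map πP) + dsum l) := by
  induction l with
  | nil => simp
  | cons q l ih =>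
    have h2 : commSum (dbl σ τ (q :: l))
        = commSum (dbl σ τ l) + comm (σ • q.1.1 + τ • q.1.2) (dbl σ τ l).sum + (σ * τ) • dterm q := by
      rw [← fstL_add_sndL, ← comm_fstL_sndL]
      simp only [dbl_cons, commSum_cons, List.sum_cons, AveragingHessianKernels.comm]
      noncomm_ring
    rw [h2, sum_dbl, ih]
    simp only [List.map_cons, commSum_cons, cross_cons, dsum_cons, πW_apply, πB_apply, πP_apply, bg_map_πP,
      fl_map_πP, AveragingHessianKernels.comm, mul_add, add_mul, smul_mul_assoc, mul_smul_comm, smul_add, smul_sub,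
      smul_smul]
    module

end Doubled

/-! ## §3 The oriented pair form and the bridges to node 5's contours and node 7a's functionals -/

section Bridges

variable {𝕜 : Type*} [RCLike 𝕜] {d : ℕ} {𝔸 : Type*} [NormedRing 𝔸] [NormedAlgebra 𝕜 𝔸]

/-- [folklore] THE ORIENTED PAIR FORM `f ↦ ((W_f, B_f), +1)`; node 5's lists negate the letters of backward bonds,
so the flag `−1` records the orientation. -/
def opForm (W B : Form1 d 𝔸) : Form1 d ((𝔸 × 𝔸) × ℤ) := fun κ x => ((W κ x, B κ x), 1)

omit [NormedRing 𝔸] [NormedAlgebra 𝕜 𝔸] in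
/-- [folklore] `opForm W B κ x = ((W κ x, B κ x), 1)`. -/
@[simp] theorem opForm_apply (W B : Form1 d 𝔸) (κ : Fin d) (x : Fin d → ℤ) :
    opForm W B κ x = ((W κ x, B κ x), 1) := rfl

/-- [folklore] Fluctuation projection of the oriented pair form. -/
@[simp] theorem mapForm_πW_opForm (W B : Form1 d 𝔸) : mapForm πW (opForm W B) = W := by funext κ x; rfl

/-- [folklore] Background projection of the oriented pair form. -/
@[simp] theorem mapForm_πB_opForm (W B : Form1 d 𝔸) : mapForm πB (opForm W B) = B := by funext κ x; rfl

/-- [folklore] Pair projection of the oriented pair form is node 6's `pairForm`. -/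
@[simp] theorem mapForm_πP_opForm (W B : Form1 d 𝔸) : mapForm πP (opForm W B) = pairForm W B := by
  funext κ x; rfl

/-- [folklore] The loop letters project to node 5's loop letters of `W`. -/
theorem map_πW_loopC (W B : Form1 d 𝔸) (L : ℕ) (μ : Fin d) (y : Fin d → ℤ) (b : Fin d → ℕ) :
    (loopC (opForm W B) L μ y b).map πW = loopC W L μ y b := by
  rw [loopC_map, mapForm_πW_opForm]

/-- [folklore] The loop letters project to node 5's loop letters of `B`. -/
theorem map_πB_loopC (W B : Form1 d 𝔸) (L : ℕ) (μ : Fin d) (y : Fin d → ℤ) (b : Fin d → ℕ) :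
    (loopC (opForm W B) L μ y b).map πB = loopC B L μ y b := by
  rw [loopC_map, mapForm_πB_opForm]

/-- [folklore] The loop letters project to the loop letters of the pair form. -/
theorem map_πP_loopC (W B : Form1 d 𝔸) (L : ℕ) (μ : Fin d) (y : Fin d → ℤ) (b : Fin d → ℕ) :
    (loopC (opForm W B) L μ y b).map πP = loopC (pairForm W B) L μ y b := by
  rw [loopC_map, mapForm_πP_opForm]

/-- [folklore] The coarse-bond letters project to node 5's straight segment of `W`. -/
theorem map_πW_segUp (W B : Form1 d 𝔸) (z : Fin d → ℤ) (κ : Fin d) (n : ℕ) :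
    (segUp (opForm W B) z κ n).map πW = segUp W z κ n := by
  rw [segUp_map, mapForm_πW_opForm]

/-- [folklore] The coarse-bond letters project to node 5's straight segment of `B`. -/
theorem map_πB_segUp (W B : Form1 d 𝔸) (z : Fin d → ℤ) (κ : Fin d) (n : ℕ) :
    (segUp (opForm W B) z κ n).map πB = segUp B z κ n := by
  rw [segUp_map, mapForm_πB_opForm]

/-- [folklore] The coarse-bond letters project to the straight segment of the pair form. -/
theorem map_πP_segUp (W B : Form1 d 𝔸) (z : Fin d → ℤ) (κ : Fin d) (n : ℕ) :
    (segUp (opForm W B) z κ n).map πP = segUp (pairForm W B) z κ n := by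
  rw [segUp_map, mapForm_πP_opForm]

/-- [folklore] The oriented pair form DECORATED with its bondwise commutator (bookkeeping device). -/
def opbwForm (W B : Form1 d 𝔸) : Form1 d (((𝔸 × 𝔸) × ℤ) × 𝔸) := fun κ x => (((W κ x, B κ x), 1), comm (W κ x) (B κ x))

/-- [folklore] First projection of the decorated form. -/
theorem mapForm_fst_opbwForm (W B : Form1 d 𝔸) :
    mapForm (AddMonoidHom.fst _ _) (opbwForm W B) = opForm W B := by funext κ x; rfl

/-- [folklore] Second projection of the decorated form is node 7a's `bw`. -/
theorem mapForm_snd_opbwForm (W B : Form1 d 𝔸) :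
    mapForm (AddMonoidHom.snd _ _) (opbwForm W B) = bw W B := by funext κ x; rfl

/-- [folklore] On a letter `±(opbwForm W B)_f` the in-block commutator of the first component is the second
component (ORIENTATION-CORRECTNESS of `dterm`: `[w,b]` forward, `[−b,−w] = −[w,b]` backward). -/
theorem dterm_fst_eq_snd_of_lettersIn {P : (Fin d → ℤ) → Prop} (W B : Form1 d 𝔸) {l : List (((𝔸 × 𝔸) × ℤ) × 𝔸)}
    (h : LettersIn (opbwForm W B) P l) : ∀ a ∈ l, dterm a.1 = a.2 := by
  intro a ha
  obtain ⟨κ, x, -, hax | hax⟩ := h a ha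
  · rw [hax]; simp [opbwForm, dterm]
  · rw [hax]
    simp only [opbwForm, Prod.neg_mk, dterm, comm_neg_left, comm_neg_right, neg_neg, comm_anticomm (W κ x) (B κ x)]
    norm_num

/-- [folklore] `dsum` of the first projection equals the sum of the second projection on such lists. -/
theorem dsum_map_fst_eq_sum_map_snd {P : (Fin d → ℤ) → Prop} (W B : Form1 d 𝔸) {l : List (((𝔸 × 𝔸) × ℤ) × 𝔸)}
    (h : LettersIn (opbwForm W B) P l) : dsum (l.map Prod.fst) = (l.map Prod.snd).sum := by
  unfold dsum
  rw [List.map_map]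
  congr 1
  exact List.map_congr_left fun a ha => dterm_fst_eq_snd_of_lettersIn W B h a ha

/-- [folklore] THE IN-BLOCK CONTACTS ALONG A LOOP sum to node 5's loop letter sum of the commutator form `bw W B`. -/
theorem dsum_loopC (W B : Form1 d 𝔸) (L : ℕ) (μ : Fin d) (y : Fin d → ℤ) {b : Fin d → ℕ} (hb : b ∈ box d L) :
    dsum (loopC (opForm W B) L μ y b) = (loopC (bw W B) L μ y b).sum := by
  have h := lettersIn_loopC (opbwForm W B) L μ y hb
  have h1 : (loopC (opbwForm W B) L μ y b).map Prod.fst = loopC (opForm W B) L μ y b := by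
    rw [← mapForm_fst_opbwForm, ← loopC_map]; rfl
  have h2 : (loopC (opbwForm W B) L μ y b).map Prod.snd = loopC (bw W B) L μ y b := by
    rw [← mapForm_snd_opbwForm, ← loopC_map]; rfl
  rw [← h1, ← h2, dsum_map_fst_eq_sum_map_snd W B h]

/-- [folklore] THE IN-BLOCK CONTACTS ALONG THE COARSE BOND. -/
theorem dsum_segUp (W B : Form1 d 𝔸) (L : ℕ) (μ : Fin d) (y : Fin d → ℤ) :
    dsum (segUp (opForm W B) ((L : ℤ) • y) μ L) = (segUp (bw W B) ((L : ℤ) • y) μ L).sum := by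
  have h := lettersIn_cSeg (opbwForm W B) L μ y
  have h1 : (segUp (opbwForm W B) ((L : ℤ) • y) μ L).map Prod.fst = segUp (opForm W B) ((L : ℤ) • y) μ L := by
    rw [← mapForm_fst_opbwForm, ← segUp_map]; rfl
  have h2 : (segUp (opbwForm W B) ((L : ℤ) • y) μ L).map Prod.snd = segUp (bw W B) ((L : ℤ) • y) μ L := by
    rw [← mapForm_snd_opbwForm, ← segUp_map]; rfl
  rw [← h1, ← h2, dsum_map_fst_eq_sum_map_snd W B h]

/-- [folklore] THE DIAGONAL BRIDGE: node 7a's `cross` along the pair form `(W, W)` is twice node-2's `commSum`. -/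
theorem cross_loopC_pairForm_self (W : Form1 d 𝔸) (L : ℕ) (μ : Fin d) (y : Fin d → ℤ) (b : Fin d → ℕ) :
    cross (loopC (pairForm W W) L μ y b) = (2 : ℤ) • commSum (loopC W L μ y b) := by
  have h : loopC (pairForm W W) L μ y b = (loopC W L μ y b).map fun a => (a, a) := by
    rw [show (fun a : 𝔸 => (a, a)) = ⇑((AddMonoidHom.id 𝔸).prod (AddMonoidHom.id 𝔸)) from rfl, loopC_map]; rfl
  rw [h, cross_diag]

/-- [folklore] The diagonal bridge on the coarse bond. -/
theorem cross_segUp_pairForm_self (W : Form1 d 𝔸) (z : Fin d → ℤ) (κ : Fin d) (n : ℕ) :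
    cross (segUp (pairForm W W) z κ n) = (2 : ℤ) • commSum (segUp W z κ n) := by
  have h : segUp (pairForm W W) z κ n = (segUp W z κ n).map fun a => (a, a) := by
    rw [show (fun a : 𝔸 => (a, a)) = ⇑((AddMonoidHom.id 𝔸).prod (AddMonoidHom.id 𝔸)) from rfl, segUp_map]; rfl
  rw [h, cross_diag]

/-- [folklore] The loop letter sum is the contour sum minus the coarse-bond sum (the loop returns along `−c`). -/
theorem sum_loopC (A : Form1 d 𝔸) (L : ℕ) (μ : Fin d) (y : Fin d → ℤ) (b : Fin d → ℕ) :
    (loopC A L μ y b).sum = (gammaC A L μ y b).sum - (segUp A ((L : ℤ) • y) μ L).sum := by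
  simp only [loopC, List.sum_append, rev_sum]; abel

/-- [folklore] Summed over the block: `Σ_x A(loop_x) = linAvg A − L^d · A(c)`. -/
theorem sum_box_sum_loopC (A : Form1 d 𝔸) (L : ℕ) (μ : Fin d) (y : Fin d → ℤ) :
    ∑ b ∈ box d L, (loopC A L μ y b).sum = linAvg A L μ y - (L ^ d) • (segUp A ((L : ℤ) • y) μ L).sum := by
  have hcard : (box d L).card = L ^ d := by simp [AffineAveraging.box, Fintype.card_piFinset]
  simp only [sum_loopC, Finset.sum_sub_distrib, Finset.sum_const, hcard, linAvg]

end Bridges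

/-! ## §4 The ENGINE: the multiplicative two-jet of `exp(c • Σ_i Y_i) · holPath ℓ_c` from local logs of the loops -/

section Engine

variable {𝕜 : Type*} [RCLike 𝕜] {𝔸 : Type*} [NormedRing 𝔸] [NormedAlgebra 𝕜 𝔸]

/-- [folklore] Retyping the two coefficients of a multiplicative jet along equalities. -/
theorem MulJet.of_eq {F : 𝕜 → 𝔸} {P R P' R' : 𝔸} (h : MulJet F P R) (hP : P = P') (hR : R = R') :
    MulJet F P' R' := by
  rw [← hP, ← hR]; exact h

/-- [folklore] The `ℕ`-scalar `L^n •` as a `𝕜`-scalar. -/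
theorem nsmul_pow_eq_smul (L n : ℕ) (X : 𝔸) : (L ^ n) • X = ((L : 𝕜) ^ n) • X := by
  rw [← Nat.cast_smul_eq_nsmul 𝕜, Nat.cast_pow]

/-- [folklore] The `ℤ`-scalar `(L:ℤ)^n •` as a `𝕜`-scalar. -/
theorem zsmul_pow_eq_smul (L n : ℕ) (X : 𝔸) : ((L : ℤ) ^ n) • X = ((L : 𝕜) ^ n) • X := by
  rw [← Int.cast_smul_eq_zsmul 𝕜, Int.cast_pow, Int.cast_natCast]

/-- [folklore] The `ℤ`-scalar `2 •` as the `𝕜`-scalar `2 •`. -/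
theorem two_zsmul_eq_smul (X : 𝔸) : (2 : ℤ) • X = (2 : 𝕜) • X := by
  rw [← Int.cast_smul_eq_zsmul 𝕜, Int.cast_ofNat]

/-- [folklore] `L ≥ 1 ⇒ (L : 𝕜)^n ≠ 0`. -/
theorem castPow_ne_zero {L : ℕ} (hL : 0 < L) (n : ℕ) : ((L : 𝕜) ^ n) ≠ 0 :=
  pow_ne_zero _ (Nat.cast_ne_zero.mpr hL.ne')

/-- [folklore] `x = Ld⁻¹ • v` from `Ld • x = v` (how the inverse block volume is moved across). -/
theorem eq_inv_smul_of_smul_eq {Ld : 𝕜} (hLd : Ld ≠ 0) {x v : 𝔸} (h : Ld • x = v) : x = Ld⁻¹ • v := by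
  rw [← h, smul_smul, inv_mul_cancel₀ hLd, one_smul]

/-- [folklore] Scalar bookkeeping: `(4Ld)·½·(Ld⁻¹A + C + Ld⁻¹K) = 2A + 2Ld·C + 2K`. -/
theorem four_smul_half_smul {Ld : 𝕜} (hLd : Ld ≠ 0) (A C K : 𝔸) :
    (4 * Ld) • ((2 : 𝕜)⁻¹ • (Ld⁻¹ • A + C + Ld⁻¹ • K)) = (2 : 𝕜) • A + (2 * Ld) • C + (2 : 𝕜) • K := by
  have h1 : (4 : 𝕜) * Ld * 2⁻¹ * Ld⁻¹ = 2 := by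
    rw [mul_right_comm (4 : 𝕜) Ld 2⁻¹, mul_assoc, mul_inv_cancel₀ hLd, mul_one]; norm_num
  have h2 : (4 : 𝕜) * Ld * 2⁻¹ = 2 * Ld := by rw [mul_right_comm]; norm_num
  calc (4 * Ld) • ((2 : 𝕜)⁻¹ • (Ld⁻¹ • A + C + Ld⁻¹ • K))
      = ((4 : 𝕜) * Ld * 2⁻¹ * Ld⁻¹) • A + ((4 : 𝕜) * Ld * 2⁻¹) • C + ((4 : 𝕜) * Ld * 2⁻¹ * Ld⁻¹) • K := by
        simp only [smul_add, smul_smul, mul_assoc]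
    _ = (2 : 𝕜) • A + (2 * Ld) • C + (2 : 𝕜) • K := by rw [h1, h2]

/-- [folklore] `quad l = ½((Σ l)² + commSum l)` — node 2's `two_smul_quad`, halved. -/
theorem quad_eq_half_smul (l : List 𝔸) : quad 𝕜 l = (2 : 𝕜)⁻¹ • (l.sum * l.sum + commSum l) := by
  rw [← two_smul_quad 𝕜 l, smul_smul, inv_mul_cancel₀ (by norm_num : (2 : 𝕜) ≠ 0), one_smul]

variable [CompleteSpace 𝔸]

/-- [folklore] THE QUOTIENT LEMMA, multiplicative-jet form (Baker–Campbell–Hausdorff to second order, log-free):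
if `F = 1 + tP + t²(q_F + ½P²) + o`, `F⁰ = 1 + tP⁰ + t²(q_{F⁰} + ½P⁰²) + o`, `F⁰·J = 1` near `0`, and `Φ` is a
local logarithm of `F·J` with additive jet `(a, b)`, then `a = P − P⁰` and `b = q_F − q_{F⁰} − ½[P, P⁰]`. -/
theorem MulJet.log_jets_of_mul_inv {Φ F F0 J : 𝕜 → 𝔸} {P qF P0 qF0 a b PJ RJ : 𝔸}
    (hF : MulJet F P (qF + (2 : 𝕜)⁻¹ • (P * P))) (hF0 : MulJet F0 P0 (qF0 + (2 : 𝕜)⁻¹ • (P0 * P0)))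
    (hJ : MulJet J PJ RJ) (hinv : ∀ᶠ t in 𝓝 (0 : 𝕜), F0 t * J t = 1)
    (hΦ : AddJet Φ a b) (hG : ∀ᶠ t in 𝓝 (0 : 𝕜), exp (Φ t) = F t * J t) :
    a = P - P0 ∧ b = qF - qF0 - (2 : 𝕜)⁻¹ • (P * P0 - P0 * P) := by
  -- the jets of `J` from `F⁰ · J = 1`
  obtain ⟨hPJ, hRJ⟩ := ((hF0.mul hJ).congr hinv).unique mulJet_one
  have hPJ' : PJ = -P0 := by
    have := hPJ; rw [add_comm] at this; exact eq_neg_of_add_eq_zero_left this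
  have hRJ' : RJ = -(qF0 + (2 : 𝕜)⁻¹ • (P0 * P0)) + P0 * P0 := by
    have h := hRJ
    rw [hPJ'] at h
    have : RJ = -(qF0 + (2 : 𝕜)⁻¹ • (P0 * P0)) - P0 * -P0 := by
      rw [eq_sub_iff_add_eq, eq_neg_iff_add_eq_zero, ← h]; abel
    rw [this]; noncomm_ring
  -- the jets of `F · J`, then the log lemma for `Φ`
  obtain ⟨ha, hb⟩ := hΦ.jets_of_exp_eq (hF.mul hJ) hG
  refine ⟨by rw [ha, hPJ']; abel, ?_⟩
  rw [hb, hPJ', hRJ']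
  simp only [smul_sub, smul_add, mul_add, add_mul, mul_neg, neg_mul, smul_neg]
  module

/-- [folklore] THE QUOTIENT LEMMA for local logarithms: the additive jets of local logarithms of `F`, of `F⁰` and of
`F · J` with `F⁰ · J = 1` near `0` are related by `a = p − p⁰`, `b = q − q⁰ − ½[p, p⁰]`. -/
theorem AddJet.jets_of_exp_eq_mul_inv {Ψ Ψ0 Φ F F0 J : 𝕜 → 𝔸} {p q p0 q0 a b PJ RJ : 𝔸}
    (hΨ : AddJet Ψ p q) (hF : ∀ᶠ t in 𝓝 (0 : 𝕜), exp (Ψ t) = F t)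
    (hΨ0 : AddJet Ψ0 p0 q0) (hF0 : ∀ᶠ t in 𝓝 (0 : 𝕜), exp (Ψ0 t) = F0 t)
    (hJ : MulJet J PJ RJ) (hinv : ∀ᶠ t in 𝓝 (0 : 𝕜), F0 t * J t = 1)
    (hΦ : AddJet Φ a b) (hG : ∀ᶠ t in 𝓝 (0 : 𝕜), exp (Φ t) = F t * J t) :
    a = p - p0 ∧ b = q - q0 - (2 : 𝕜)⁻¹ • (p * p0 - p0 * p) :=
  MulJet.log_jets_of_mul_inv ((AddJet.mulJet_exp hΨ).congr hF) ((AddJet.mulJet_exp hΨ0).congr hF0) hJ hinv hΦ hG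

/-- [folklore] A local logarithm of a holonomy path has jets `(Σ l, ½·commSum l)` (node 4b's `log_holPath_jets` with
node 2's `two_smul_quad`). -/
theorem log_holPath_addJet (l : List 𝔸) {Y : 𝕜 → 𝔸} {S Q : 𝔸} (hY : AddJet Y S Q)
    (hlog : ∀ᶠ t in 𝓝 (0 : 𝕜), exp (Y t) = holPath 𝕜 l t) :
    S = l.sum ∧ Q = (2 : 𝕜)⁻¹ • commSum l := by
  obtain ⟨h1, h2⟩ := hY.jets_of_exp_eq (mulJet_holPath l) hlog
  refine ⟨h1, ?_⟩
  rw [h2, quad_eq_half_smul, smul_add, add_sub_cancel_left]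

/-- [folklore] **THE ENGINE.**  Given local logarithms `Y_i` (jets `(S_i, Q_i)`) of the holonomy paths of the lists
`ℓ_i`, `i ∈ s`, and a further list `ℓ_c`, the curve `t ↦ exp(c • Σ_{i∈s} Y_i t) · holPath ℓ_c t` — the shape of
B7 (15)/(42) along a ray — has the multiplicative two-jet `1 + tP + t²(R₀ + ½P²) + o(t²)` with
`P = c•Σ_i Σℓ_i + Σℓ_c` and `R₀ = ½(c•Σ_i commSum ℓ_i + commSum ℓ_c + [c•Σ_i Σℓ_i, Σℓ_c])`. -/
theorem engine {ι : Type*} (s : Finset ι) (ℓ : ι → List 𝔸) (ℓc : List 𝔸) (c : 𝕜)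
    {Y : ι → 𝕜 → 𝔸} {S Q : ι → 𝔸} (hY : ∀ i ∈ s, AddJet (Y i) (S i) (Q i))
    (hlog : ∀ i ∈ s, ∀ᶠ t in 𝓝 (0 : 𝕜), exp (Y i t) = holPath 𝕜 (ℓ i) t) :
    MulJet (fun t => exp (c • ∑ i ∈ s, Y i t) * holPath 𝕜 ℓc t)
      (c • ∑ i ∈ s, (ℓ i).sum + ℓc.sum)
      ((2 : 𝕜)⁻¹ • (c • ∑ i ∈ s, commSum (ℓ i) + commSum ℓc + comm (c • ∑ i ∈ s, (ℓ i).sum) ℓc.sum)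
        + (2 : 𝕜)⁻¹ • ((c • ∑ i ∈ s, (ℓ i).sum + ℓc.sum) * (c • ∑ i ∈ s, (ℓ i).sum + ℓc.sum))) := by
  have hS : ∑ i ∈ s, S i = ∑ i ∈ s, (ℓ i).sum :=
    Finset.sum_congr rfl fun i hi => (log_holPath_addJet (ℓ i) (hY i hi) (hlog i hi)).1
  have hQ : ∑ i ∈ s, Q i = (2 : 𝕜)⁻¹ • ∑ i ∈ s, commSum (ℓ i) := by
    rw [Finset.smul_sum]
    exact Finset.sum_congr rfl fun i hi => (log_holPath_addJet (ℓ i) (hY i hi) (hlog i hi)).2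
  have hZ : AddJet (fun t => c • ∑ i ∈ s, Y i t) (c • ∑ i ∈ s, (ℓ i).sum)
      (c • ((2 : 𝕜)⁻¹ • ∑ i ∈ s, commSum (ℓ i))) := by
    have h := (AddJet.sum s hY).smul c
    rw [hS, hQ] at h
    exact h
  refine (hZ.mulJet_exp.mul (mulJet_holPath ℓc)).of_eq rfl ?_
  rw [quad_eq_half_smul]
  simp only [AveragingHessianKernels.comm, mul_add, add_mul, smul_mul_assoc, mul_smul_comm, smul_add,
    smul_sub, smul_smul]
  module

end Engine

/-! ## §5 THE RAY JETS of (15)/(42) in the product chart and the re-centred (V-H) stencil -/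

section Rays

variable {𝕜 : Type*} [RCLike 𝕜] {d : ℕ} {𝔸 : Type*} [NormedRing 𝔸] [NormedAlgebra 𝕜 𝔸]

/-- [folklore] LOOP LETTERS of the product-chart ray through the block point `x = L•y + b`: the doubled letters
(`σW_f, τB_f` forward; `−τB_f, −σW_f` backward) along node 5's closed loop `Γ_{b,x} ∪ (−c)`. -/
def loopLetters (σ τ : 𝕜) (W B : Form1 d 𝔸) (L : ℕ) (μ : Fin d) (y : Fin d → ℤ) (b : Fin d → ℕ) : List 𝔸 :=
  dbl σ τ (loopC (opForm W B) L μ y b)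

/-- [folklore] COARSE-BOND LETTERS of the ray: the doubled letters along `c = [L•y, L•y + L e_μ]`. -/
def cLetters (σ τ : 𝕜) (W B : Form1 d 𝔸) (L : ℕ) (μ : Fin d) (y : Fin d → ℤ) : List 𝔸 :=
  dbl σ τ (segUp (opForm W B) ((L : ℤ) • y) μ L)

/-- [folklore] Letter sum of the loop letters. -/
theorem sum_loopLetters (σ τ : 𝕜) (W B : Form1 d 𝔸) (L : ℕ) (μ : Fin d) (y : Fin d → ℤ) (b : Fin d → ℕ) :
    (loopLetters σ τ W B L μ y b).sum = σ • (loopC W L μ y b).sum + τ • (loopC B L μ y b).sum := by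
  rw [loopLetters, sum_dbl, map_πW_loopC, map_πB_loopC]

/-- [folklore] Letter sum of the coarse-bond letters. -/
theorem sum_cLetters (σ τ : 𝕜) (W B : Form1 d 𝔸) (L : ℕ) (μ : Fin d) (y : Fin d → ℤ) :
    (cLetters σ τ W B L μ y).sum
      = σ • (segUp W ((L : ℤ) • y) μ L).sum + τ • (segUp B ((L : ℤ) • y) μ L).sum := by
  rw [cLetters, sum_dbl, map_πW_segUp, map_πB_segUp]

/-- [folklore] Ordered commutator sum of the loop letters: `σ²·C(W) + τ²·C(B) + στ·(cross(W,B) + contacts)`, the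
contacts being node 5's loop sum of the commutator one-form `[W,B]_bw` (orientation-correct, §3 `dsum_loopC`). -/
theorem commSum_loopLetters (σ τ : 𝕜) (W B : Form1 d 𝔸) (L : ℕ) (μ : Fin d) (y : Fin d → ℤ) {b : Fin d → ℕ}
    (hb : b ∈ box d L) :
    commSum (loopLetters σ τ W B L μ y b)
      = σ ^ 2 • commSum (loopC W L μ y b) + τ ^ 2 • commSum (loopC B L μ y b)
        + (σ * τ) • (cross (loopC (pairForm W B) L μ y b) + (loopC (bw W B) L μ y b).sum) := by
  rw [loopLetters, commSum_dbl, map_πW_loopC, map_πB_loopC, map_πP_loopC, dsum_loopC W B L μ y hb]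

/-- [folklore] Ordered commutator sum of the coarse-bond letters. -/
theorem commSum_cLetters (σ τ : 𝕜) (W B : Form1 d 𝔸) (L : ℕ) (μ : Fin d) (y : Fin d → ℤ) :
    commSum (cLetters σ τ W B L μ y)
      = σ ^ 2 • commSum (segUp W ((L : ℤ) • y) μ L) + τ ^ 2 • commSum (segUp B ((L : ℤ) • y) μ L)
        + (σ * τ) • (cross (segUp (pairForm W B) ((L : ℤ) • y) μ L) + (segUp (bw W B) ((L : ℤ) • y) μ L).sum) := by
  rw [cLetters, commSum_dbl, map_πW_segUp, map_πB_segUp, map_πP_segUp, dsum_segUp]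

/-- [folklore] Block sum of the loop letter sums: `σ•(Z_W − L^d·W(c)) + τ•(Z_B − L^d·B(c))`. -/
theorem sum_box_sum_loopLetters (σ τ : 𝕜) (W B : Form1 d 𝔸) (L : ℕ) (μ : Fin d) (y : Fin d → ℤ) :
    ∑ b ∈ box d L, (loopLetters σ τ W B L μ y b).sum
      = σ • (linAvg W L μ y - ((L : 𝕜) ^ d) • (segUp W ((L : ℤ) • y) μ L).sum)
        + τ • (linAvg B L μ y - ((L : 𝕜) ^ d) • (segUp B ((L : ℤ) • y) μ L).sum) := by
  simp only [sum_loopLetters, Finset.sum_add_distrib, ← Finset.smul_sum, sum_box_sum_loopC,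
    nsmul_pow_eq_smul (𝕜 := 𝕜)]

/-- [folklore] Block sum of the loop commutator sums. -/
theorem sum_box_commSum_loopLetters (σ τ : 𝕜) (W B : Form1 d 𝔸) (L : ℕ) (μ : Fin d) (y : Fin d → ℤ) :
    ∑ b ∈ box d L, commSum (loopLetters σ τ W B L μ y b)
      = σ ^ 2 • ∑ b ∈ box d L, commSum (loopC W L μ y b) + τ ^ 2 • ∑ b ∈ box d L, commSum (loopC B L μ y b)
        + (σ * τ) • (∑ b ∈ box d L, cross (loopC (pairForm W B) L μ y b)
            + (linAvg (bw W B) L μ y - ((L : 𝕜) ^ d) • (segUp (bw W B) ((L : ℤ) • y) μ L).sum)) := by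
  rw [Finset.sum_congr rfl fun b hb => commSum_loopLetters σ τ W B L μ y hb]
  simp only [Finset.sum_add_distrib, ← Finset.smul_sum, sum_box_sum_loopC, nsmul_pow_eq_smul (𝕜 := 𝕜)]

/-- [folklore] Node 7a's `hessU W W` over `𝕜`-scalars: `2·Σ_x commSum(loop_x) + 2[Z_W, W(c)] + 2L^d·commSum(c)`. -/
theorem hessU_self_eq_smul (W : Form1 d 𝔸) (L : ℕ) (μ : Fin d) (y : Fin d → ℤ) :
    hessU W W L μ y = (2 : 𝕜) • ∑ b ∈ box d L, commSum (loopC W L μ y b)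
      + (comm (linAvg W L μ y) (segUp W ((L : ℤ) • y) μ L).sum
          + comm (linAvg W L μ y) (segUp W ((L : ℤ) • y) μ L).sum)
      + ((L : 𝕜) ^ d) • ((2 : 𝕜) • commSum (segUp W ((L : ℤ) • y) μ L)) := by
  rw [hessU, Finset.sum_congr rfl fun b _ => cross_loopC_pairForm_self W L μ y b, ← Finset.smul_sum,
    cross_segUp_pairForm_self, two_zsmul_eq_smul (𝕜 := 𝕜), two_zsmul_eq_smul (𝕜 := 𝕜),
    zsmul_pow_eq_smul (𝕜 := 𝕜)]

/-- [folklore] Node 7a's `hessU W B` over `𝕜`-scalars. -/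
theorem hessU_eq_smul (W B : Form1 d 𝔸) (L : ℕ) (μ : Fin d) (y : Fin d → ℤ) :
    hessU W B L μ y = ∑ b ∈ box d L, cross (loopC (pairForm W B) L μ y b)
      + (comm (linAvg W L μ y) (segUp B ((L : ℤ) • y) μ L).sum
          + comm (linAvg B L μ y) (segUp W ((L : ℤ) • y) μ L).sum)
      + ((L : 𝕜) ^ d) • cross (segUp (pairForm W B) ((L : ℤ) • y) μ L) := by
  rw [hessU, zsmul_pow_eq_smul (𝕜 := 𝕜)]

/-- [folklore] Node 7a's `vhU W B` over `𝕜`-scalars. -/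
theorem vhU_eq_smul (W B : Form1 d 𝔸) (L : ℕ) (μ : Fin d) (y : Fin d → ℤ) :
    vhU W B L μ y = ((L : 𝕜) ^ d) • hessU W B L μ y + ((L : 𝕜) ^ d) • linAvg (bw W B) L μ y
      - comm (linAvg W L μ y) (linAvg B L μ y) := by
  rw [vhU, zsmul_pow_eq_smul (𝕜 := 𝕜), zsmul_pow_eq_smul (𝕜 := 𝕜)]

/-- [folklore] THE FIRST RAY COEFFICIENT (closed form): `P = L^{−d} • (σ•Z_W + τ•Z_B)`. -/
def rayP (σ τ : 𝕜) (W B : Form1 d 𝔸) (L : ℕ) (μ : Fin d) (y : Fin d → ℤ) : 𝔸 :=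
  ((L : 𝕜) ^ d)⁻¹ • (σ • linAvg W L μ y + τ • linAvg B L μ y)

/-- [folklore] THE SECOND RAY COEFFICIENT of a local logarithm (closed form):
`(4L^d)⁻¹ • (σ²•hessU W W + τ²•hessU B B + 2στ•(hessU W B + Z_{[W,B]_bw}))`. -/
def rayQ (σ τ : 𝕜) (W B : Form1 d 𝔸) (L : ℕ) (μ : Fin d) (y : Fin d → ℤ) : 𝔸 :=
  (4 * (L : 𝕜) ^ d)⁻¹ • (σ ^ 2 • hessU W W L μ y + τ ^ 2 • hessU B B L μ y
    + (2 * σ * τ) • (hessU W B L μ y + linAvg (bw W B) L μ y))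

/-- [folklore] `L^d • rayP = σ•Z_W + τ•Z_B`. -/
theorem smul_rayP {L : ℕ} (hL : 0 < L) (σ τ : 𝕜) (W B : Form1 d 𝔸) (μ : Fin d) (y : Fin d → ℤ) :
    ((L : 𝕜) ^ d) • rayP σ τ W B L μ y = σ • linAvg W L μ y + τ • linAvg B L μ y := by
  rw [rayP, smul_smul, mul_inv_cancel₀ (castPow_ne_zero hL d), one_smul]

/-- [folklore] `(4L^d) • rayQ = σ²•hessU W W + τ²•hessU B B + 2στ•(hessU W B + Z_{[W,B]_bw})`. -/
theorem smul_rayQ {L : ℕ} (hL : 0 < L) (σ τ : 𝕜) (W B : Form1 d 𝔸) (μ : Fin d) (y : Fin d → ℤ) :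
    (4 * (L : 𝕜) ^ d) • rayQ σ τ W B L μ y = σ ^ 2 • hessU W W L μ y + τ ^ 2 • hessU B B L μ y
      + (2 * σ * τ) • (hessU W B L μ y + linAvg (bw W B) L μ y) := by
  rw [rayQ, smul_smul, mul_inv_cancel₀ (mul_ne_zero (by norm_num) (castPow_ne_zero hL d)), one_smul]

variable [CompleteSpace 𝔸]

/-- [folklore] Log-free cancellation `e^{Z}·U(c)·U(c)⁻¹·e^{−Z} = 1` with `Z = c • X` (node 3 `holPath_mul_inv`, node 6
`exp_tsmul_mul_exp_neg`). -/
theorem rayInv_cancel (c : 𝕜) (X : 𝔸) (l : List 𝔸) (t : 𝕜) :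
    exp (c • X) * holPath 𝕜 l t * (holPath 𝕜 (invPath l) t * exp (-(c • X))) = 1 := by
  rw [mul_assoc, ← mul_assoc (holPath 𝕜 l t), holPath_mul_inv, one_mul, exp_tsmul_mul_exp_neg]

/-- [folklore] **THEOREM P (pure fluctuation ray `U_f = e^{rW_f}`; node 5's lists verbatim).**  If `Y_x` are local
logarithms of the loop holonomies `holPath (loopC W … b′)` and `Ψ` is a local logarithm of (42)
`exp(L^{−d} Σ_x Y_x) · holPath (segUp W (L•y) μ L)` with additive jet `(p, q)`, then `L^d • p = Z_W` — B7 (14) IS the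
linear term — and `(4L^d) • q = hessU W W`. -/
theorem rayJets_pure {L : ℕ} (hL : 0 < L) (W : Form1 d 𝔸) (μ : Fin d) (y : Fin d → ℤ)
    {Y : (Fin d → ℕ) → 𝕜 → 𝔸} {S Q : (Fin d → ℕ) → 𝔸} (hY : ∀ b ∈ box d L, AddJet (Y b) (S b) (Q b))
    (hlog : ∀ b ∈ box d L, ∀ᶠ t in 𝓝 (0 : 𝕜), exp (Y b t) = holPath 𝕜 (loopC W L μ y b) t)
    {Ψ : 𝕜 → 𝔸} {p q : 𝔸} (hΨ : AddJet Ψ p q)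
    (hexp : ∀ᶠ t in 𝓝 (0 : 𝕜), exp (Ψ t)
      = exp (((L : 𝕜) ^ d)⁻¹ • ∑ b ∈ box d L, Y b t) * holPath 𝕜 (segUp W ((L : ℤ) • y) μ L) t) :
    ((L : 𝕜) ^ d) • p = linAvg W L μ y ∧ (4 * (L : 𝕜) ^ d) • q = hessU W W L μ y := by
  have hLd : ((L : 𝕜) ^ d) ≠ 0 := castPow_ne_zero hL d
  obtain ⟨hp, hq⟩ := hΨ.jets_of_exp_eq
    (engine (box d L) (loopC W L μ y) (segUp W ((L : ℤ) • y) μ L) ((L : 𝕜) ^ d)⁻¹ hY hlog) hexp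
  rw [add_sub_cancel_right] at hq
  have hD : ∑ b ∈ box d L, (loopC W L μ y b).sum
      = linAvg W L μ y - ((L : 𝕜) ^ d) • (segUp W ((L : ℤ) • y) μ L).sum := by
    rw [sum_box_sum_loopC, nsmul_pow_eq_smul (𝕜 := 𝕜)]
  constructor
  · rw [hp, smul_add, smul_smul, mul_inv_cancel₀ hLd, one_smul, hD, sub_add_cancel]
  · rw [hq, comm_smul_left, four_smul_half_smul hLd, hD, hessU_self_eq_smul (𝕜 := 𝕜) W L μ y]
    simp only [AveragingHessianKernels.comm, mul_sub, sub_mul, smul_mul_assoc, mul_smul_comm, smul_sub,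
      smul_smul]
    module

/-- [folklore] **THE PRODUCT-CHART RAY** `U_f(r) = e^{rσW_f} e^{rτB_f}`: the curve (42) has the multiplicative two-jet
with coefficients `rayP`, `rayQ + ½ rayP²`. -/
theorem mulJet_ray {L : ℕ} (hL : 0 < L) (σ τ : 𝕜) (W B : Form1 d 𝔸) (μ : Fin d) (y : Fin d → ℤ)
    {Y : (Fin d → ℕ) → 𝕜 → 𝔸} {S Q : (Fin d → ℕ) → 𝔸} (hY : ∀ b ∈ box d L, AddJet (Y b) (S b) (Q b))
    (hlog : ∀ b ∈ box d L, ∀ᶠ t in 𝓝 (0 : 𝕜), exp (Y b t) = holPath 𝕜 (loopLetters σ τ W B L μ y b) t) :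
    MulJet (fun t => exp (((L : 𝕜) ^ d)⁻¹ • ∑ b ∈ box d L, Y b t) * holPath 𝕜 (cLetters σ τ W B L μ y) t)
      (rayP σ τ W B L μ y)
      (rayQ σ τ W B L μ y + (2 : 𝕜)⁻¹ • (rayP σ τ W B L μ y * rayP σ τ W B L μ y)) := by
  have hLd : ((L : 𝕜) ^ d) ≠ 0 := castPow_ne_zero hL d
  have h4 : (4 * (L : 𝕜) ^ d) ≠ 0 := mul_ne_zero (by norm_num) hLd
  have hE := engine (box d L) (loopLetters σ τ W B L μ y) (cLetters σ τ W B L μ y) ((L : 𝕜) ^ d)⁻¹ hY hlog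
  have hP : ((L : 𝕜) ^ d)⁻¹ • ∑ b ∈ box d L, (loopLetters σ τ W B L μ y b).sum + (cLetters σ τ W B L μ y).sum
      = rayP σ τ W B L μ y := by
    rw [rayP]
    refine eq_inv_smul_of_smul_eq hLd ?_
    rw [smul_add, smul_smul, mul_inv_cancel₀ hLd, one_smul, sum_box_sum_loopLetters, sum_cLetters]
    module
  have hQ : (2 : 𝕜)⁻¹ • (((L : 𝕜) ^ d)⁻¹ • ∑ b ∈ box d L, commSum (loopLetters σ τ W B L μ y b)
        + commSum (cLetters σ τ W B L μ y)
        + comm (((L : 𝕜) ^ d)⁻¹ • ∑ b ∈ box d L, (loopLetters σ τ W B L μ y b).sum)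
            (cLetters σ τ W B L μ y).sum)
      = rayQ σ τ W B L μ y := by
    rw [rayQ]
    refine eq_inv_smul_of_smul_eq h4 ?_
    rw [comm_smul_left, four_smul_half_smul hLd, sum_box_commSum_loopLetters, commSum_cLetters,
      sum_box_sum_loopLetters, sum_cLetters, hessU_self_eq_smul (𝕜 := 𝕜) W L μ y,
      hessU_self_eq_smul (𝕜 := 𝕜) B L μ y, hessU_eq_smul (𝕜 := 𝕜) W B L μ y]
    simp only [AveragingHessianKernels.comm, mul_add, add_mul, mul_sub, sub_mul, smul_mul_assoc, mul_smul_comm,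
      smul_add, smul_sub, smul_smul]
    module
  exact hE.of_eq hP (by rw [hQ, hP])

/-- [folklore] **THEOREM A (product-chart ray jets).**  Every local logarithm `Ψ` (jet `(p, q)`) of (42) along
`U_f(r) = e^{rσW_f} e^{rτB_f}` has `p = rayP`, `q = rayQ`. -/
theorem rayJets {L : ℕ} (hL : 0 < L) (σ τ : 𝕜) (W B : Form1 d 𝔸) (μ : Fin d) (y : Fin d → ℤ)
    {Y : (Fin d → ℕ) → 𝕜 → 𝔸} {S Q : (Fin d → ℕ) → 𝔸} (hY : ∀ b ∈ box d L, AddJet (Y b) (S b) (Q b))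
    (hlog : ∀ b ∈ box d L, ∀ᶠ t in 𝓝 (0 : 𝕜), exp (Y b t) = holPath 𝕜 (loopLetters σ τ W B L μ y b) t)
    {Ψ : 𝕜 → 𝔸} {p q : 𝔸} (hΨ : AddJet Ψ p q)
    (hexp : ∀ᶠ t in 𝓝 (0 : 𝕜), exp (Ψ t)
      = exp (((L : 𝕜) ^ d)⁻¹ • ∑ b ∈ box d L, Y b t) * holPath 𝕜 (cLetters σ τ W B L μ y) t) :
    p = rayP σ τ W B L μ y ∧ q = rayQ σ τ W B L μ y := by
  obtain ⟨h1, h2⟩ := hΨ.jets_of_exp_eq (mulJet_ray hL σ τ W B μ y hY hlog) hexp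
  exact ⟨h1, by rw [h2, add_sub_cancel_right]⟩

/-- [folklore] **THEOREM A, inverse-free form**: `L^d • p = σ•Z_W + τ•Z_B` and
`(4L^d) • q = σ²•hessU W W + τ²•hessU B B + 2στ•(hessU W B + Z_{[W,B]_bw})`. -/
theorem rayJets_smul {L : ℕ} (hL : 0 < L) (σ τ : 𝕜) (W B : Form1 d 𝔸) (μ : Fin d) (y : Fin d → ℤ)
    {Y : (Fin d → ℕ) → 𝕜 → 𝔸} {S Q : (Fin d → ℕ) → 𝔸} (hY : ∀ b ∈ box d L, AddJet (Y b) (S b) (Q b))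
    (hlog : ∀ b ∈ box d L, ∀ᶠ t in 𝓝 (0 : 𝕜), exp (Y b t) = holPath 𝕜 (loopLetters σ τ W B L μ y b) t)
    {Ψ : 𝕜 → 𝔸} {p q : 𝔸} (hΨ : AddJet Ψ p q)
    (hexp : ∀ᶠ t in 𝓝 (0 : 𝕜), exp (Ψ t)
      = exp (((L : 𝕜) ^ d)⁻¹ • ∑ b ∈ box d L, Y b t) * holPath 𝕜 (cLetters σ τ W B L μ y) t) :
    ((L : 𝕜) ^ d) • p = σ • linAvg W L μ y + τ • linAvg B L μ y ∧
    (4 * (L : 𝕜) ^ d) • q = σ ^ 2 • hessU W W L μ y + τ ^ 2 • hessU B B L μ y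
      + (2 * σ * τ) • (hessU W B L μ y + linAvg (bw W B) L μ y) := by
  obtain ⟨h1, h2⟩ := rayJets hL σ τ W B μ y hY hlog hΨ hexp
  exact ⟨by rw [h1, smul_rayP hL], by rw [h2, smul_rayQ hL]⟩

/-- [folklore] **THEOREM B (the re-centred (V-H) stencil, raw form).**  With `F_{σ,τ}` the curve (42) along the
product-chart ray and `F_{0,τ}` the same along the pure-background ray (logs `Y⁰_x`), the re-centred curve
`G = F_{σ,τ} · F_{0,τ}⁻¹` — the inverse written log-free as `holPath (invPath c-letters) · exp(−L^{−d} Σ Y⁰)` — has, for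
every local logarithm `Φ` with jet `(a, b₂)`: `a = rayP_{σ,τ} − rayP_{0,τ}`,
`b₂ = rayQ_{σ,τ} − rayQ_{0,τ} − ½[rayP_{σ,τ}, rayP_{0,τ}]`. -/
theorem vhJets {L : ℕ} (hL : 0 < L) (σ τ : 𝕜) (W B : Form1 d 𝔸) (μ : Fin d) (y : Fin d → ℤ)
    {Y Y0 : (Fin d → ℕ) → 𝕜 → 𝔸} {S Q S0 Q0 : (Fin d → ℕ) → 𝔸}
    (hY : ∀ b ∈ box d L, AddJet (Y b) (S b) (Q b))
    (hlog : ∀ b ∈ box d L, ∀ᶠ t in 𝓝 (0 : 𝕜), exp (Y b t) = holPath 𝕜 (loopLetters σ τ W B L μ y b) t)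
    (hY0 : ∀ b ∈ box d L, AddJet (Y0 b) (S0 b) (Q0 b))
    (hlog0 : ∀ b ∈ box d L, ∀ᶠ t in 𝓝 (0 : 𝕜), exp (Y0 b t) = holPath 𝕜 (loopLetters 0 τ W B L μ y b) t)
    {Φ : 𝕜 → 𝔸} {a b₂ : 𝔸} (hΦ : AddJet Φ a b₂)
    (hG : ∀ᶠ t in 𝓝 (0 : 𝕜), exp (Φ t)
      = (exp (((L : 𝕜) ^ d)⁻¹ • ∑ b ∈ box d L, Y b t) * holPath 𝕜 (cLetters σ τ W B L μ y) t)
        * (holPath 𝕜 (invPath (cLetters 0 τ W B L μ y)) t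
            * exp (-(((L : 𝕜) ^ d)⁻¹ • ∑ b ∈ box d L, Y0 b t)))) :
    a = rayP σ τ W B L μ y - rayP 0 τ W B L μ y ∧
    b₂ = rayQ σ τ W B L μ y - rayQ 0 τ W B L μ y
      - (2 : 𝕜)⁻¹ • (rayP σ τ W B L μ y * rayP 0 τ W B L μ y - rayP 0 τ W B L μ y * rayP σ τ W B L μ y) := by
  have hF := mulJet_ray hL σ τ W B μ y hY hlog
  have hF0 := mulJet_ray hL 0 τ W B μ y hY0 hlog0
  have hZ0 : AddJet (fun t => -(((L : 𝕜) ^ d)⁻¹ • ∑ b ∈ box d L, Y0 b t))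
      (-(((L : 𝕜) ^ d)⁻¹ • ∑ b ∈ box d L, S0 b)) (-(((L : 𝕜) ^ d)⁻¹ • ∑ b ∈ box d L, Q0 b)) :=
    ((AddJet.sum (box d L) hY0).smul (((L : 𝕜) ^ d)⁻¹)).neg
  have hJ : MulJet (fun t => holPath 𝕜 (invPath (cLetters 0 τ W B L μ y)) t
      * exp (-(((L : 𝕜) ^ d)⁻¹ • ∑ b ∈ box d L, Y0 b t))) _ _ :=
    (mulJet_holPath (invPath (cLetters 0 τ W B L μ y))).mul hZ0.mulJet_exp
  have hinv : ∀ᶠ t in 𝓝 (0 : 𝕜),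
      (exp (((L : 𝕜) ^ d)⁻¹ • ∑ b ∈ box d L, Y0 b t) * holPath 𝕜 (cLetters 0 τ W B L μ y) t)
        * (holPath 𝕜 (invPath (cLetters 0 τ W B L μ y)) t
            * exp (-(((L : 𝕜) ^ d)⁻¹ • ∑ b ∈ box d L, Y0 b t))) = 1 :=
    Eventually.of_forall fun t => rayInv_cancel _ _ _ t
  exact MulJet.log_jets_of_mul_inv hF hF0 hJ hinv hΦ hG

/-- [folklore] **THEOREM B (the re-centred (V-H) stencil, closed form)**: `L^d • a = σ•Z_W` and
`(4L^{2d}) • b₂ = σ²•(L^d • hessU W W) + 2στ • vhU W B` — node 7a's `vhU` (`L^d·hessU W B + L^d·Z_{[W,B]_bw} −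
[Z_W, Z_B]`) IS the `στ`-part of the second jet of `log[Φ_b(e^{σW}e^{τB})·Φ_b(e^{τB})⁻¹]` along rays. -/
theorem vhJets_smul {L : ℕ} (hL : 0 < L) (σ τ : 𝕜) (W B : Form1 d 𝔸) (μ : Fin d) (y : Fin d → ℤ)
    {Y Y0 : (Fin d → ℕ) → 𝕜 → 𝔸} {S Q S0 Q0 : (Fin d → ℕ) → 𝔸}
    (hY : ∀ b ∈ box d L, AddJet (Y b) (S b) (Q b))
    (hlog : ∀ b ∈ box d L, ∀ᶠ t in 𝓝 (0 : 𝕜), exp (Y b t) = holPath 𝕜 (loopLetters σ τ W B L μ y b) t)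
    (hY0 : ∀ b ∈ box d L, AddJet (Y0 b) (S0 b) (Q0 b))
    (hlog0 : ∀ b ∈ box d L, ∀ᶠ t in 𝓝 (0 : 𝕜), exp (Y0 b t) = holPath 𝕜 (loopLetters 0 τ W B L μ y b) t)
    {Φ : 𝕜 → 𝔸} {a b₂ : 𝔸} (hΦ : AddJet Φ a b₂)
    (hG : ∀ᶠ t in 𝓝 (0 : 𝕜), exp (Φ t)
      = (exp (((L : 𝕜) ^ d)⁻¹ • ∑ b ∈ box d L, Y b t) * holPath 𝕜 (cLetters σ τ W B L μ y) t)
        * (holPath 𝕜 (invPath (cLetters 0 τ W B L μ y)) t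
            * exp (-(((L : 𝕜) ^ d)⁻¹ • ∑ b ∈ box d L, Y0 b t)))) :
    ((L : 𝕜) ^ d) • a = σ • linAvg W L μ y ∧
    (4 * ((L : 𝕜) ^ d) ^ 2) • b₂
      = σ ^ 2 • (((L : 𝕜) ^ d) • hessU W W L μ y) + (2 * σ * τ) • vhU W B L μ y := by
  obtain ⟨ha, hb⟩ := vhJets hL σ τ W B μ y hY hlog hY0 hlog0 hΦ hG
  have hPσ := smul_rayP hL σ τ W B μ y
  have hP0 := smul_rayP hL (0 : 𝕜) τ W B μ y
  have hQσ := smul_rayQ hL σ τ W B μ y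
  have hQ0 := smul_rayQ hL (0 : 𝕜) τ W B μ y
  constructor
  · rw [ha, smul_sub, hPσ, hP0]; module
  · have step : (4 * ((L : 𝕜) ^ d) ^ 2) • b₂
        = ((L : 𝕜) ^ d) • ((4 * (L : 𝕜) ^ d) • rayQ σ τ W B L μ y)
          - ((L : 𝕜) ^ d) • ((4 * (L : 𝕜) ^ d) • rayQ 0 τ W B L μ y)
          - (2 : 𝕜) • ((((L : 𝕜) ^ d) • rayP σ τ W B L μ y) * (((L : 𝕜) ^ d) • rayP 0 τ W B L μ y)
              - (((L : 𝕜) ^ d) • rayP 0 τ W B L μ y) * (((L : 𝕜) ^ d) • rayP σ τ W B L μ y)) := by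
      rw [hb]
      simp only [smul_sub, smul_smul, smul_mul_assoc, mul_smul_comm]
      module
    rw [step, hQσ, hQ0, hPσ, hP0, vhU_eq_smul (𝕜 := 𝕜) W B L μ y]
    simp only [AveragingHessianKernels.comm, mul_add, add_mul, smul_mul_assoc, mul_smul_comm,
      smul_add, smul_sub, smul_smul]
    module

/-- [folklore] **(b1) DICTIONARY, single bonds**: for `W = single f w`, `B = single f′ v` (node 7a §3) the closed form
of THEOREM B is `(4L^{2d}) • b₂ = 2στ • (vhCount_b(f,f′) • [w, v])` — node 7a's integer kernel `vhCount` (normalised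
`vhKer`, packed `vhS`) IS the `στ`-coefficient. -/
theorem vhJets_single {L : ℕ} (hL : 0 < L) (σ τ : 𝕜) (f f' : Bond d) (w v : 𝔸) (μ : Fin d) (y : Fin d → ℤ)
    {Y Y0 : (Fin d → ℕ) → 𝕜 → 𝔸} {S Q S0 Q0 : (Fin d → ℕ) → 𝔸}
    (hY : ∀ b ∈ box d L, AddJet (Y b) (S b) (Q b))
    (hlog : ∀ b ∈ box d L, ∀ᶠ t in 𝓝 (0 : 𝕜),
      exp (Y b t) = holPath 𝕜 (loopLetters σ τ (single f w) (single f' v) L μ y b) t)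
    (hY0 : ∀ b ∈ box d L, AddJet (Y0 b) (S0 b) (Q0 b))
    (hlog0 : ∀ b ∈ box d L, ∀ᶠ t in 𝓝 (0 : 𝕜),
      exp (Y0 b t) = holPath 𝕜 (loopLetters 0 τ (single f w) (single f' v) L μ y b) t)
    {Φ : 𝕜 → 𝔸} {a b₂ : 𝔸} (hΦ : AddJet Φ a b₂)
    (hG : ∀ᶠ t in 𝓝 (0 : 𝕜), exp (Φ t)
      = (exp (((L : 𝕜) ^ d)⁻¹ • ∑ b ∈ box d L, Y b t) * holPath 𝕜 (cLetters σ τ (single f w) (single f' v) L μ y) t)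
        * (holPath 𝕜 (invPath (cLetters 0 τ (single f w) (single f' v) L μ y)) t
            * exp (-(((L : 𝕜) ^ d)⁻¹ • ∑ b ∈ box d L, Y0 b t)))) :
    (4 * ((L : 𝕜) ^ d) ^ 2) • b₂ = (2 * σ * τ) • (vhCount L μ y f f' • comm w v) := by
  obtain ⟨-, h⟩ := vhJets_smul hL σ τ (single f w) (single f' v) μ y hY hlog hY0 hlog0 hΦ hG
  rw [h]
  simp only [hessU_single, vhU_single, comm_self, smul_zero, zero_add]

end Rays

/-! ## §6 POLARISATION: `hessU` along `s•W + s′•W′`, THEOREM H and the (b2) dictionary -/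

section Polarisation

variable {𝕜 : Type*} [RCLike 𝕜] {d : ℕ} {𝔸 : Type*} [NormedRing 𝔸] [NormedAlgebra 𝕜 𝔸]

/-- [folklore] The letter map of the polarised ray, `(w, w′) ↦ s•w + s′•w′`. -/
def polHom (s s' : 𝕜) : (𝔸 × 𝔸) →+ 𝔸 :=
  AddMonoidHom.mk' (fun p => s • p.1 + s' • p.2) fun p q => by
    simp only [Prod.fst_add, Prod.snd_add, smul_add]; abel

/-- [folklore] Evaluation of `polHom`. -/
@[simp] theorem polHom_apply (s s' : 𝕜) (p : 𝔸 × 𝔸) : polHom s s' p = s • p.1 + s' • p.2 := rfl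

/-- [folklore] `s•W + s′•W′` is the push-forward of node 6's pair form along `polHom`. -/
theorem mapForm_polHom_pairForm (s s' : 𝕜) (W W' : Form1 d 𝔸) :
    mapForm (polHom s s') (pairForm W W') = s • W + s' • W' := by
  funext κ x; rfl

/-- [folklore] Letter sum of a polarised list. -/
theorem sum_map_polHom (s s' : 𝕜) (l : List (𝔸 × 𝔸)) :
    (l.map (polHom s s')).sum = s • (bg l).sum + s' • (fl l).sum := by
  induction l with
  | nil => simp
  | cons p l ih =>
    simp only [List.map_cons, List.sum_cons, polHom_apply, ih, bg_cons, fl_cons, smul_add]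
    abel

/-- [folklore] THE SCALAR POLARISATION OF node 2's `commSum`: `commSum(s•w + s′•w′) = s²·commSum w + s′²·commSum w′
+ ss′·cross(w, w′)` (node 7a's `commSum_map_add` is `s = s′ = 1`). -/
theorem commSum_map_polHom (s s' : 𝕜) (l : List (𝔸 × 𝔸)) :
    commSum (l.map (polHom s s')) = s ^ 2 • commSum (bg l) + s' ^ 2 • commSum (fl l) + (s * s') • cross l := by
  induction l with
  | nil => simp
  | cons p l ih =>
    rw [List.map_cons, commSum_cons, ih, sum_map_polHom, bg_cons, fl_cons, commSum_cons, commSum_cons, cross_cons]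
    simp only [polHom_apply, AveragingHessianKernels.comm, mul_add, add_mul, smul_mul_assoc,
      mul_smul_comm, smul_add, smul_sub, smul_smul]
    module

/-- [folklore] Node 5's loop letters of `s•W + s′•W′` are the polarised pair-form letters. -/
theorem loopC_linComb (s s' : 𝕜) (W W' : Form1 d 𝔸) (L : ℕ) (μ : Fin d) (y : Fin d → ℤ) (b : Fin d → ℕ) :
    loopC (s • W + s' • W') L μ y b = (loopC (pairForm W W') L μ y b).map (polHom s s') := by
  rw [loopC_map, mapForm_polHom_pairForm]

/-- [folklore] The same on the coarse bond. -/
theorem segUp_linComb (s s' : 𝕜) (W W' : Form1 d 𝔸) (z : Fin d → ℤ) (κ : Fin d) (n : ℕ) :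
    segUp (s • W + s' • W') z κ n = (segUp (pairForm W W') z κ n).map (polHom s s') := by
  rw [segUp_map, mapForm_polHom_pairForm]

/-- [folklore] Background letters of the pair form along a loop (node 6's `bg_gammaC_pairForm` for `loopC`). -/
theorem bg_loopC_pairForm (W W' : Form1 d 𝔸) (L : ℕ) (μ : Fin d) (y : Fin d → ℤ) (b : Fin d → ℕ) :
    bg (loopC (pairForm W W') L μ y b) = loopC W L μ y b := by
  have h := loopC_map (AddMonoidHom.fst 𝔸 𝔸) (pairForm W W') L μ y b
  rw [mapForm_fst_pairForm] at h
  simpa [bg] using h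

/-- [folklore] Fluctuation letters of the pair form along a loop. -/
theorem fl_loopC_pairForm (W W' : Form1 d 𝔸) (L : ℕ) (μ : Fin d) (y : Fin d → ℤ) (b : Fin d → ℕ) :
    fl (loopC (pairForm W W') L μ y b) = loopC W' L μ y b := by
  have h := loopC_map (AddMonoidHom.snd 𝔸 𝔸) (pairForm W W') L μ y b
  rw [mapForm_snd_pairForm] at h
  simpa [fl] using h

/-- [folklore] Node 5's `linAvg` is `𝕜`-linear in the form: `Z_{s•W + s′•W′} = s•Z_W + s′•Z_{W′}`. -/
theorem linAvg_linComb (s s' : 𝕜) (W W' : Form1 d 𝔸) (L : ℕ) (μ : Fin d) (y : Fin d → ℤ) :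
    linAvg (s • W + s' • W') L μ y = s • linAvg W L μ y + s' • linAvg W' L μ y := by
  have h1 := linAvg_mapForm (AddMonoidHom.fst 𝔸 𝔸) (pairForm W W') L μ y
  rw [mapForm_fst_pairForm] at h1
  have h2 := linAvg_mapForm (AddMonoidHom.snd 𝔸 𝔸) (pairForm W W') L μ y
  rw [mapForm_snd_pairForm] at h2
  rw [← mapForm_polHom_pairForm, linAvg_mapForm, h1, h2]
  rfl

/-- [folklore] **POLARISATION OF node 7a's W-HESSIAN FUNCTIONAL**:
`hessU (s•W + s′•W′) (s•W + s′•W′) = s²•hessU W W + 2ss′•hessU W W′ + s′²•hessU W′ W′`. -/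
theorem hessU_linComb_self (s s' : 𝕜) (W W' : Form1 d 𝔸) (L : ℕ) (μ : Fin d) (y : Fin d → ℤ) :
    hessU (s • W + s' • W') (s • W + s' • W') L μ y
      = s ^ 2 • hessU W W L μ y + (2 * s * s') • hessU W W' L μ y + s' ^ 2 • hessU W' W' L μ y := by
  have hCb : ∀ b ∈ box d L, commSum (loopC (s • W + s' • W') L μ y b)
      = s ^ 2 • commSum (loopC W L μ y b) + s' ^ 2 • commSum (loopC W' L μ y b)
        + (s * s') • cross (loopC (pairForm W W') L μ y b) := fun b _ => by
    rw [loopC_linComb, commSum_map_polHom, bg_loopC_pairForm, fl_loopC_pairForm]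
  rw [hessU_self_eq_smul (𝕜 := 𝕜) (s • W + s' • W') L μ y, Finset.sum_congr rfl hCb, linAvg_linComb,
    segUp_linComb, commSum_map_polHom, sum_map_polHom, bg_segUp_pairForm, fl_segUp_pairForm,
    hessU_self_eq_smul (𝕜 := 𝕜) W L μ y, hessU_self_eq_smul (𝕜 := 𝕜) W' L μ y,
    hessU_eq_smul (𝕜 := 𝕜) W W' L μ y]
  simp only [Finset.sum_add_distrib, ← Finset.smul_sum]
  simp only [AveragingHessianKernels.comm, mul_add, add_mul, smul_mul_assoc, mul_smul_comm, smul_add, smul_smul]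
  module

variable [CompleteSpace 𝔸]

/-- [folklore] **THEOREM H ((b2), polarised ray jets).**  Along `U_f = e^{r(sW_f + s′W′_f)}` every local logarithm
`Ψ` (jet `(p, q)`) of (42) has `L^d • p = s•Z_W + s′•Z_{W′}` and
`(4L^d) • q = s²•hessU W W + 2ss′•hessU W W′ + s′²•hessU W′ W′`; so the `ss′`-coefficient of `q` is
`hessU W W′/(2L^d) = H_b(W, W′)` of node 7a. -/
theorem rayJets_polarised {L : ℕ} (hL : 0 < L) (s s' : 𝕜) (W W' : Form1 d 𝔸) (μ : Fin d) (y : Fin d → ℤ)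
    {Y : (Fin d → ℕ) → 𝕜 → 𝔸} {S Q : (Fin d → ℕ) → 𝔸} (hY : ∀ b ∈ box d L, AddJet (Y b) (S b) (Q b))
    (hlog : ∀ b ∈ box d L, ∀ᶠ t in 𝓝 (0 : 𝕜), exp (Y b t) = holPath 𝕜 (loopC (s • W + s' • W') L μ y b) t)
    {Ψ : 𝕜 → 𝔸} {p q : 𝔸} (hΨ : AddJet Ψ p q)
    (hexp : ∀ᶠ t in 𝓝 (0 : 𝕜), exp (Ψ t)
      = exp (((L : 𝕜) ^ d)⁻¹ • ∑ b ∈ box d L, Y b t) * holPath 𝕜 (segUp (s • W + s' • W') ((L : ℤ) • y) μ L) t) :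
    ((L : 𝕜) ^ d) • p = s • linAvg W L μ y + s' • linAvg W' L μ y ∧
    (4 * (L : 𝕜) ^ d) • q
      = s ^ 2 • hessU W W L μ y + (2 * s * s') • hessU W W' L μ y + s' ^ 2 • hessU W' W' L μ y := by
  obtain ⟨h1, h2⟩ := rayJets_pure hL (s • W + s' • W') μ y hY hlog hΨ hexp
  exact ⟨by rw [h1, linAvg_linComb], by rw [h2, hessU_linComb_self]⟩

/-- [folklore] **(b2) DICTIONARY, single bonds**: for `W = single f w`, `W′ = single f′ w′` the `ss′`-part of
`(4L^d) • q` is `2·hessCount_b(f, f′) • [w, w′]` and the diagonal parts vanish (`[w,w] = 0`) — node 7a's integer kernel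
`hessCount` (normalised `hessKer`, packed `hessFF`) IS the coefficient. -/
theorem rayJets_polarised_single {L : ℕ} (hL : 0 < L) (s s' : 𝕜) (f f' : Bond d) (w w' : 𝔸) (μ : Fin d)
    (y : Fin d → ℤ) {Y : (Fin d → ℕ) → 𝕜 → 𝔸} {S Q : (Fin d → ℕ) → 𝔸}
    (hY : ∀ b ∈ box d L, AddJet (Y b) (S b) (Q b))
    (hlog : ∀ b ∈ box d L, ∀ᶠ t in 𝓝 (0 : 𝕜),
      exp (Y b t) = holPath 𝕜 (loopC (s • single f w + s' • single f' w') L μ y b) t)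
    {Ψ : 𝕜 → 𝔸} {p q : 𝔸} (hΨ : AddJet Ψ p q)
    (hexp : ∀ᶠ t in 𝓝 (0 : 𝕜), exp (Ψ t)
      = exp (((L : 𝕜) ^ d)⁻¹ • ∑ b ∈ box d L, Y b t)
        * holPath 𝕜 (segUp (s • single f w + s' • single f' w') ((L : ℤ) • y) μ L) t) :
    (4 * (L : 𝕜) ^ d) • q = (2 * s * s') • (hessCount L μ y f f' • comm w w') := by
  obtain ⟨-, h⟩ := rayJets_polarised hL s s' (single f w) (single f' w') μ y hY hlog hΨ hexp
  rw [h]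
  simp only [hessU_single, comm_self, smul_zero, zero_add, add_zero]

end Polarisation

end

end Literature.MathematicalPhysics.QuantumFieldTheory.Balaban1983to89.Beta.AveragingHessianJets
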